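import Literature.MathematicalPhysics.QuantumFieldTheory.Balaban1983to89.B9SectCDiffCutModelToy6

/-!
# `Balaban1983to89.B9SectCDiffCutModelToy7` — the COARSE INVERSE of the one-level toy: the off-diagonal weighted
row mass of `E₂ = Q′G′²Q′*` from above, the weighted diagonal dominance of `E₂` at mass `a/B` for an absolute `a`,
hence `E₂` invertible with `C := E₂⁻¹ ∈ 𝒟(0, −4, 3a⁴)` on the toy frame (census
`b2b-balaban-r1/SectC-inst-census.md` §6 (a⁵), second half, parts 2–3; notes N12–N13)

B9 = T. Bałaban, *Propagators for lattice gauge theories in a background field*, Commun. Math. Phys. **99**, 389–434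
(1985) [Balaban1985BackgroundPropagators].

CITATION HEADER (lean-in-tree rule 2026-08-18).  Cell `pub-balaban`, unit `b2b-balaban-r1-g17` (READER GROUP A,
lineage r1, gen 17), journal claim `SECTC-DIFF-CUTMODEL-TOY7`.  Source: doi:10.1007/bf01240355, held
`paper:balaban1985-cmp99-background-propagators`, journal page = PDF page + 388.  This unit re-read NO page and
introduces NO quotation: the only printed shape inhabited here is the target shape of the coarse sequence datum,
`MOne.mC : OpDec F bS bS p p 0 (−4) c C` of `…B9SectCDiffAssembly`, which carries the scale power of B9's Theorem 3.2
(3.48), p. 398 [PDF 10] (sentence quoted VERBATIM in the header of `…B9SectCDiffAssembly`; the classes `𝒟(n, k, c)`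
themselves transcribe Theorem 3.1 (3.42), p. 397 [PDF 9], quoted in the header of `…B9SectCDiffEstimate`); the present
declarations point to those quotations BY NAME only.  Tree inputs (by name): `B9SectCDiffEstimate.{Frame, OpDec}` (via
`B9SectCDiffCutModelToy6.opDec_coarse_of_rowLe`), `B9SectCDiffCutModelToy.{bdist, Qp}`, `B9SectCDiffCutModelToy2.Qpt`,
`B9SectCDiffCutModelToy3.toyFrame`, `B9SectCDiffCutModelToy4.{ι, ι_eq, ι_lt, ι_injective}`,
`B9SectCDiffCutModelToy5.{Gr, Gr_nonneg, Gr_mass_le, cosh_half_le, dι_ge}`, `B9SectCDiffCutModelToy6.{IsWt, IsWt.nonneg,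
RowLe, RowLe.inv_of_diag, ewt, isWt_ewt, opDec_coarse_of_rowLe, sum_block, sum_exp_neg_le, E2, E2_apply, Gr_symm,
E2_diag_ge}`; Mathlib's `geom_sum_mul_neg`, `finProdFinEquiv`, `Finset.sum_fiberwise_of_maps_to`, `Fin.revPerm`,
`Real.add_one_le_exp`, `Real.exp_one_lt_d9`, `Matrix.{one_apply, diagonal_mul, sub_apply}` otherwise.  Cell rows: GAPS
C-r1g13-1 (the cut model), C-r1g14-1 … C-r1g16-3 (the toys 1–6), this module's row C-r1g17-1; census §6 (a⁵) /
notes N10–N13.  No `HarnessLib` fact, no named-fact `Prop`, no `instance`, no new predicate (Toy6's `IsWt` / `RowLe`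
are used as typed there: `RowLe` is PROVED here for `1 − D⁻¹E₂` and, through Toy6's engine, for `E₂⁻¹`); no `sorry`.

## WHAT THIS MODULE DOES

Toy6 (gen 16, third leaf) typed the coarse operator `E₂ := Qp·(G′·G′)·Qpt` of the toy line `Fin n × Fin B` (block
averaging `Qp`, block indicator `Qpt`, `G′ = G_r(μ) = (∂*∂ + μ)⁻¹` of Toy5), proved the engine `RowLe.inv_of_diag`
(`RowLe w (1 − D⁻¹E) q`, `q < 1`, `D ≥ d > 0` ⇒ `IsUnit E ∧ RowLe w E⁻¹ ((1 − q)⁻¹d⁻¹)`), its packaging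
`opDec_coarse_of_rowLe` into the class `𝒟(0, k, c)` of the toy frame, and HALF of the engine's hypothesis for `E₂`:
the diagonal from below, `E2_diag_ge`.  This leaf supplies the other half and closes the coarse inverse:

* §1–§2 geometric sums on the line, reindexed by the linear index `ι` (`sum_line_exp_le : Σ_z e^{−r|ι w − ι z|} ≤
  (1 + e^{−r})(1 − e^{−r})⁻¹`), and the block geometry of the exponential kernel: the sites of the blocks left /
  right of the block of `w` lie at linear distance `≥ o(w) + 1` / `≥ B − o(w)` (`o` = in-block offset), so the
  OUT-OF-BLOCK kernel mass at `w` is the pair of boundary-layer tails `(e^{−r(o+1)} + e^{−r(B−o)})(1 − e^{−r})⁻¹`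
  (`sum_out_block_exp_le`), whose block sum is `≤ 2e^{−r}(1 − e^{−r})⁻¹` (`sum_block_tails_le`) — only `O(1/r)` of
  the `B` sites of a block see the outside; the coarse weight is absorbed into the fine rate,
  `e^{−r|Δι|}e^{κ·bdist} ≤ e^{κ}e^{−(r − κ/B)|Δι|}` (`kernel_weight_le`, from Toy5's `dι_ge`);
* §3 with Toy5's pointwise bound `G′(w,z) ≤ (4/m)e^{−(m/2)|ι w − ι z|}` at `μ = m²` (`Gr_mass_le`): the full row sum
  `Σ_z G′(w,z) ≤ R₀ := (4/m)(1 + e^{−m/2})(1 − e^{−m/2})⁻¹` (`Gr_rowsum_le`), the weighted out-of-block mass at a site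
  of offset `o`, `Σ_{z ∉ blk w} G′(w,z)e^{κ·bdist} ≤ c₁·(e^{−s(o+1)} + e^{−s(B−o)})`, `c₁ := (4/m)e^{κ}(1 − e^{−s})⁻¹`,
  `s := m/2 − κ/B > 0` (`out_block_weighted_le`), and the full weighted row sum `Σ_z G′(w,z)e^{κ·bdist(blk w, blk z)} ≤
  R₁ := (4/m)e^{κ}(1 + e^{−s})(1 − e^{−s})⁻¹` (`weighted_rowsum_le`);
* §4 THE OFF-DIAGONAL WEIGHTED ROW MASS OF `E₂` (census (a⁵) part 2): writing `Σ_{J≠I} E₂(I,J)e^{κ|I−J|} =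
  B⁻¹Σ_{x∈I}Σ_w G′(x,w)T_I(w)` with `T_I(w) := Σ_{z∉I} G′(w,z)e^{κ|I − blk z|}` (`Tob`, `E2_offdiag_weighted_eq`, a
  finite rearrangement), and splitting `w ∈ I` (`T_I(w) ≤ c₁·tails(o(w))` by §3, then `Σ_{x∈I}G′(x,w) ≤ R₀` by the
  symmetry of `G′`) from `w ∉ I` (`T_I(w) ≤ e^{κ|I − blk w|}R₁` by the triangle inequality of the weight, then
  `Σ_{w∉I}G′(x,w)e^{κ|I − blk w|} ≤ c₁·tails(o(x))` by §3 again): **`E2_offdiag_weighted_le : Σ_{J≠I}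
  E₂(m²)(I,J)e^{κ|I−J|} ≤ odB := B⁻¹(R₀ + R₁)·c₁·T_L`**, `T_L := 2e^{−s}(1 − e^{−s})⁻¹` — of size `O(B⁴/m⁴ · 1/(Bs))
  = O(B⁴/a⁵)` at `m = a/B`, against the diagonal `≳ B⁴/a⁴` of Toy6;
* §5 THE ASSEMBLY (census (a⁵) part 3): the generic `rowLe_of_offdiag` (entrywise `E ≥ 0`, `E(i,i) ≥ d > 0`,
  off-diagonal weighted row mass `≤ Ω` ⇒ `RowLe w (1 − diag(E(i,i))⁻¹·E) (Ω/d)`), hence with Toy6's engine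
  **`isUnit_E2_inv_rowLe`** (`odB/d < 1` ⇒ `IsUnit E₂ ∧ RowLe (ewt κ) E₂⁻¹ ((1 − odB/d)⁻¹d⁻¹)`) and
  **`E2_inv_opDec`** (`2·odB ≤ d`, `2d⁻¹ ≤ c·B⁻⁴`, `0 ≤ κ`, `δ₀ ≤ κ` ⇒ `E₂⁻¹ ∈ 𝒟(0, −4, c)` on `toyFrame`);
* §6 THE NUMERIC COROLLARY at `κ = 1/2`, `μ = (a/B)²`, `16384 ≤ a ≤ B`: elementary bounds `(1 − e^{−r})⁻¹ ≤ 1 + 1/r`,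
  `e^{1/2} ≤ 5/3` give `R₀ ≤ 24B²/a²`, `R₁ ≤ 40B²/(a(a−1))`, `c₁ ≤ 20B²/(a(a−1))`, `T_L ≤ 6B/(a−1)`, **`odB ≤
  7680·B⁴/(a²(a−1)³)`** (`odB_num_le`); Toy6's `E2_diag_ge` with `cosh_half_le` gives **`E₂(I,I) ≥ B⁴(a−6)²/a⁶`**
  (`E2_diag_ge_num`); `15360a⁴ ≤ (a−1)³(a−6)²` for `a ≥ 16384` gives the dominance `2·odB ≤ d`, and `2a² ≤ 3(a−6)²`
  the constant: **`isUnit_E2_num : IsUnit (E₂((a/B)²))`** and **`E2_inv_opDec_num : E₂((a/B)²)⁻¹ ∈ 𝒟(0, −4, 3a⁴)`**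
  on `toyFrame n B N hN δ₀` for `δ₀ ≤ 1/2` — constants free of `B`, `n`, `N`: the field SHAPE `mC` of the cut model's
  first sequence, inhabited by the genuine coarse inverse of the toy with `∂ ≠ 0`.

## WHAT IS NOT CLAIMED (ABSOLUTE RULE)

Nothing printed is asserted.  Everything here is finite sums of exponentials, finite-dimensional linear algebra and the
one-dimensional discrete Helmholtz kernel bounds of Toy5 (folklore); B9's Theorems 3.1–3.3 concern gauge-covariant
operators in a background field on a four-dimensional multi-level lattice, and nothing here bears on them or on their
printed proofs — in particular the dominance argument of §4–§5 is the GENERIC weighted-`ℓ^∞` one of Toy6, not B9's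
(3.47)–(3.61).  HONEST CAVEAT on the constants: the threshold `a ≥ 16384` and the constant `3a⁴` are artefacts of the
crude inputs `4/m` and rate `m/2` of Toy5's `Gr_mass_le` (true rate `arccosh(1 + μ/2) ≈ m`) and of the wasteful
triangle inequalities of §4 (to leading order in `1/a`, `B → ∞`, the parametric ratio `odB/d` of §4–§5 is `≈ 2240/a`
and the numeric corollary of §6 spends another factor `≈ 7` on round constants; the true ratio is `O(1/a)` with a
constant of order ten); no optimisation was attempted.  NOT done (census §6 (a⁵) ff.,
note N13): the same two bounds for `E₃ = Q′G′(λ + ∂*∂)⁻¹G′Q′*` (the second coarse inverse of the Woodbury form of the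
sequence datum `G`, Toy6 header), the Woodbury / push-through algebra for `G` as matrices, the packaging with Toy4's
Leibniz block and gen 15's Q-records into a `TwoSeq` / `CutModel` / `EstHyp` instance with `∂ ≠ 0`, an `n`-free
majorant profile.  Value = kernel certificate that the coarse operator of the toy IS invertible in the class the cut
model demands, with explicit absolute constants — NOT summit progress.
-/

namespace Literature.MathematicalPhysics.QuantumFieldTheory.Balaban1983to89.B9SectCDiffCutModelToy7

open Finset Real
open B9SectCDiffEstimate
open B9SectCDiffCutModel
open B9SectCDiffCutModelToy
open B9SectCDiffCutModelToy2
open B9SectCDiffCutModelToy3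
open B9SectCDiffCutModelToy4
open B9SectCDiffCutModelToy5
open B9SectCDiffCutModelToy6

noncomputable section

/-! ## §1 Geometric sums on the line -/

section Line

variable {n B : ℕ} {r μ : ℝ}

/-- geometric sum over a range: `Σ_{i<N} e^{−ri} ≤ (1 − e^{−r})⁻¹`. [folklore] -/
theorem sum_range_exp_neg_le (hr : 0 < r) (N : ℕ) :
    ∑ i ∈ range N, Real.exp (-(r * (i : ℝ))) ≤ (1 - Real.exp (-r))⁻¹ := by
  have hr0 : 0 ≤ Real.exp (-r) := Real.exp_nonneg _
  have hr1 : Real.exp (-r) < 1 := by rw [← Real.exp_zero]; exact Real.exp_lt_exp.mpr (by linarith)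
  have h1 : ∑ i ∈ range N, Real.exp (-(r * (i : ℝ))) = ∑ i ∈ range N, Real.exp (-r) ^ i := by
    refine sum_congr rfl fun i _ => ?_
    rw [← Real.exp_nat_mul]; congr 1; ring
  rw [h1]
  have h2 := geom_sum_mul_neg (Real.exp (-r)) N
  have h3 : 0 < 1 - Real.exp (-r) := by linarith
  rw [← one_div, le_div_iff₀ h3, h2]
  linarith [pow_nonneg hr0 N]

/-- reindexing a line sum by the linear index `ι`. [folklore] -/
theorem sum_ι_eq (g : ℕ → ℝ) : ∑ z : Fin n × Fin B, g (ι z) = ∑ k ∈ range (n * B), g k := by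
  rw [← Fin.sum_univ_eq_sum_range (fun k => g k) (n * B)]
  exact finProdFinEquiv.sum_comp (fun i : Fin (n * B) => g i.val)

/-- the LEFT half-line sum: `Σ_{k<N, k ≤ a} e^{−r(a−k)} ≤ (1 − e^{−r})⁻¹`. [folklore] -/
theorem sum_left_exp_le (hr : 0 < r) (a N : ℕ) :
    ∑ k ∈ (range N).filter (fun k => k ≤ a), Real.exp (-(r * ((a : ℝ) - k))) ≤ (1 - Real.exp (-r))⁻¹ := by
  have hinj : Set.InjOn (fun k : ℕ => a - k) ((range N).filter (fun k => k ≤ a) : Finset ℕ) := by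
    intro k hk k' hk' h
    simp only [coe_filter, Set.mem_setOf_eq, mem_range] at hk hk'
    simp only at h; omega
  calc ∑ k ∈ (range N).filter (fun k => k ≤ a), Real.exp (-(r * ((a : ℝ) - k)))
      = ∑ d ∈ ((range N).filter (fun k => k ≤ a)).image (fun k => a - k), Real.exp (-(r * (d : ℝ))) := by
        rw [sum_image hinj]
        refine sum_congr rfl fun k hk => ?_
        rw [mem_filter] at hk
        rw [Nat.cast_sub hk.2]
    _ ≤ ∑ d ∈ range (a + 1), Real.exp (-(r * (d : ℝ))) := by
        refine sum_le_sum_of_subset_of_nonneg ?_ fun d _ _ => Real.exp_nonneg _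
        intro d hd
        rw [mem_image] at hd
        obtain ⟨k, hk, rfl⟩ := hd
        rw [mem_range]; omega
    _ ≤ (1 - Real.exp (-r))⁻¹ := sum_range_exp_neg_le hr _

/-- the RIGHT half-line sum: `Σ_{k<N, a<k} e^{−r(k−a)} ≤ e^{−r}(1 − e^{−r})⁻¹`. [folklore] -/
theorem sum_right_exp_le (hr : 0 < r) (a N : ℕ) :
    ∑ k ∈ (range N).filter (fun k => a < k), Real.exp (-(r * ((k : ℝ) - a)))
      ≤ Real.exp (-r) * (1 - Real.exp (-r))⁻¹ := by
  have hinj : Set.InjOn (fun k : ℕ => k - a - 1) ((range N).filter (fun k => a < k) : Finset ℕ) := by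
    intro k hk k' hk' h
    simp only [coe_filter, Set.mem_setOf_eq, mem_range] at hk hk'
    simp only at h; omega
  calc ∑ k ∈ (range N).filter (fun k => a < k), Real.exp (-(r * ((k : ℝ) - a)))
      = ∑ d ∈ ((range N).filter (fun k => a < k)).image (fun k => k - a - 1),
          Real.exp (-r) * Real.exp (-(r * (d : ℝ))) := by
        rw [sum_image hinj]
        refine sum_congr rfl fun k hk => ?_
        rw [mem_filter] at hk
        rw [← Real.exp_add]; congr 1
        have : ((k - a - 1 : ℕ) : ℝ) = (k : ℝ) - a - 1 := by
          rw [Nat.sub_sub, Nat.cast_sub (by omega)]; push_cast; ring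
        rw [this]; ring
    _ ≤ ∑ d ∈ range N, Real.exp (-r) * Real.exp (-(r * (d : ℝ))) := by
        refine sum_le_sum_of_subset_of_nonneg ?_ fun d _ _ =>
          mul_nonneg (Real.exp_nonneg _) (Real.exp_nonneg _)
        intro d hd
        rw [mem_image] at hd
        obtain ⟨k, hk, rfl⟩ := hd
        rw [mem_filter, mem_range] at hk
        rw [mem_range]; omega
    _ ≤ Real.exp (-r) * (1 - Real.exp (-r))⁻¹ := by
        rw [← mul_sum]
        exact mul_le_mul_of_nonneg_left (sum_range_exp_neg_le hr _) (Real.exp_nonneg _)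

/-- the RIGHT half-line sum without gap: `Σ_{k<N, b ≤ k} e^{−r(k−b)} ≤ (1 − e^{−r})⁻¹`. [folklore] -/
theorem sum_right_exp_le' (hr : 0 < r) (b N : ℕ) :
    ∑ k ∈ (range N).filter (fun k => b ≤ k), Real.exp (-(r * ((k : ℝ) - b))) ≤ (1 - Real.exp (-r))⁻¹ := by
  have hinj : Set.InjOn (fun k : ℕ => k - b) ((range N).filter (fun k => b ≤ k) : Finset ℕ) := by
    intro k hk k' hk' h
    simp only [coe_filter, Set.mem_setOf_eq, mem_range] at hk hk'
    simp only at h; omega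
  calc ∑ k ∈ (range N).filter (fun k => b ≤ k), Real.exp (-(r * ((k : ℝ) - b)))
      = ∑ d ∈ ((range N).filter (fun k => b ≤ k)).image (fun k => k - b), Real.exp (-(r * (d : ℝ))) := by
        rw [sum_image hinj]
        refine sum_congr rfl fun k hk => ?_
        rw [mem_filter] at hk
        rw [Nat.cast_sub hk.2]
    _ ≤ ∑ d ∈ range N, Real.exp (-(r * (d : ℝ))) := by
        refine sum_le_sum_of_subset_of_nonneg ?_ fun d _ _ => Real.exp_nonneg _
        intro d hd
        rw [mem_image] at hd
        obtain ⟨k, hk, rfl⟩ := hd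
        rw [mem_filter, mem_range] at hk
        rw [mem_range]; omega
    _ ≤ (1 - Real.exp (-r))⁻¹ := sum_range_exp_neg_le hr _

/-- THE TWO-SIDED LINE SUM: `Σ_z e^{−r|ι w − ι z|} ≤ (1 + e^{−r})(1 − e^{−r})⁻¹`. [folklore] -/
theorem sum_line_exp_le (hr : 0 < r) (w : Fin n × Fin B) :
    ∑ z : Fin n × Fin B, Real.exp (-(r * |(ι w : ℝ) - ι z|))
      ≤ (1 + Real.exp (-r)) * (1 - Real.exp (-r))⁻¹ := by
  rw [sum_ι_eq (fun k => Real.exp (-(r * |(ι w : ℝ) - k|)))]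
  set a := ι w
  rw [← sum_filter_add_sum_filter_not (range (n * B)) (fun k => k ≤ a)]
  have hL : ∑ k ∈ (range (n * B)).filter (fun k => k ≤ a), Real.exp (-(r * |(a : ℝ) - k|))
      ≤ (1 - Real.exp (-r))⁻¹ := by
    refine le_trans (le_of_eq (sum_congr rfl fun k hk => ?_)) (sum_left_exp_le hr a (n * B))
    rw [mem_filter] at hk
    rw [abs_of_nonneg (by simpa using (Nat.cast_le (α := ℝ)).mpr hk.2)]
  have hR : ∑ k ∈ (range (n * B)).filter (fun k => ¬ k ≤ a), Real.exp (-(r * |(a : ℝ) - k|))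
      ≤ Real.exp (-r) * (1 - Real.exp (-r))⁻¹ := by
    have hs : (range (n * B)).filter (fun k => ¬ k ≤ a) = (range (n * B)).filter (fun k => a < k) :=
      filter_congr fun k _ => not_le
    rw [hs]
    refine le_trans (le_of_eq (sum_congr rfl fun k hk => ?_)) (sum_right_exp_le hr a (n * B))
    rw [mem_filter] at hk
    rw [abs_of_nonpos (by
      have : (a : ℝ) < k := by exact_mod_cast hk.2
      linarith), neg_sub]
  calc _ ≤ (1 - Real.exp (-r))⁻¹ + Real.exp (-r) * (1 - Real.exp (-r))⁻¹ := add_le_add hL hR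
    _ = (1 + Real.exp (-r)) * (1 - Real.exp (-r))⁻¹ := by ring

end Line

/-! ## §2 Block geometry of the exponential kernel: out-of-block tails, the coarse weight -/

section Block

variable {n B : ℕ} {r : ℝ}

/-- sites in a block to the LEFT of `w`'s block lie at linear distance `≥ o(w) + 1` below `ι w`. [folklore] -/
theorem ι_add_le_of_blk_lt {w z : Fin n × Fin B} (h : z.1 < w.1) : ι z + w.2.val + 1 ≤ ι w := by
  have h1 : z.1.val + 1 ≤ w.1.val := Nat.succ_le_of_lt (Fin.lt_def.mp h)
  have h2 : B * (z.1.val + 1) ≤ B * w.1.val := Nat.mul_le_mul_left B h1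
  have h3 : z.2.val < B := z.2.isLt
  rw [ι_eq, ι_eq]
  rw [Nat.mul_add, Nat.mul_one] at h2
  omega

/-- sites in a block to the RIGHT of `w`'s block lie at linear distance `≥ B − o(w)` above `ι w`. [folklore] -/
theorem ι_add_le_of_blk_gt {w z : Fin n × Fin B} (h : w.1 < z.1) : ι w + (B - w.2.val) ≤ ι z := by
  have h1 : w.1.val + 1 ≤ z.1.val := Nat.succ_le_of_lt (Fin.lt_def.mp h)
  have h2 : B * (w.1.val + 1) ≤ B * z.1.val := Nat.mul_le_mul_left B h1
  have h3 : w.2.val < B := w.2.isLt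
  rw [ι_eq, ι_eq]
  rw [Nat.mul_add, Nat.mul_one] at h2
  omega

/-- sites of a block to the RIGHT of `w`'s block: `ι z = ι w + (B − o(w)) + B(blk z − blk w − 1) + z.2`, exactly.
[folklore] -/
theorem ι_blk_gt_eq {w z : Fin n × Fin B} (h : w.1 < z.1) :
    ι z = ι w + (B - w.2.val) + B * (z.1.val - w.1.val - 1) + z.2.val := by
  have h1 : w.1.val + 1 ≤ z.1.val := Nat.succ_le_of_lt (Fin.lt_def.mp h)
  have h3 : w.2.val < B := w.2.isLt
  rw [ι_eq, ι_eq]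
  have h4 : B * z.1.val = B * (z.1.val - w.1.val - 1) + B * w.1.val + B := by
    rw [← Nat.mul_add]
    have : z.1.val = (z.1.val - w.1.val - 1) + w.1.val + 1 := by omega
    conv_lhs => rw [this]
    ring
  omega

/-- sites of a block to the LEFT of `w`'s block: `ι w = ι z + (o(w) + 1) + B(blk w − blk z − 1) + (B − 1 − z.2)`.
[folklore] -/
theorem ι_blk_lt_eq {w z : Fin n × Fin B} (h : z.1 < w.1) :
    ι w = ι z + (w.2.val + 1) + B * (w.1.val - z.1.val - 1) + (B - 1 - z.2.val) := by
  have h1 : z.1.val + 1 ≤ w.1.val := Nat.succ_le_of_lt (Fin.lt_def.mp h)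
  have h3 : z.2.val < B := z.2.isLt
  rw [ι_eq, ι_eq]
  have h4 : B * w.1.val = B * (w.1.val - z.1.val - 1) + B * z.1.val + B := by
    rw [← Nat.mul_add]
    have : w.1.val = (w.1.val - z.1.val - 1) + z.1.val + 1 := by omega
    conv_lhs => rw [this]
    ring
  omega

/-- THE LEFT OUT-OF-BLOCK TAIL: `Σ_{z : blk z < blk w} e^{−r|ι w − ι z|} ≤ e^{−r(o(w)+1)}(1 − e^{−r})⁻¹`. [folklore] -/
theorem sum_blk_lt_exp_le (hr : 0 < r) (w : Fin n × Fin B) :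
    ∑ z ∈ univ.filter (fun z : Fin n × Fin B => z.1 < w.1), Real.exp (-(r * |(ι w : ℝ) - ι z|))
      ≤ Real.exp (-(r * ((w.2.val : ℝ) + 1))) * (1 - Real.exp (-r))⁻¹ := by
  set S := univ.filter (fun z : Fin n × Fin B => z.1 < w.1) with hS
  set a' : ℕ := ι w - (w.2.val + 1) with ha'
  have hfac : ∀ z ∈ S, Real.exp (-(r * |(ι w : ℝ) - ι z|))
      = Real.exp (-(r * ((w.2.val : ℝ) + 1))) * Real.exp (-(r * ((a' : ℝ) - ι z))) := by
    intro z hz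
    rw [hS, mem_filter] at hz
    have hk := ι_add_le_of_blk_lt hz.2
    have hcast : (a' : ℝ) = (ι w : ℝ) - (w.2.val + 1) := by
      rw [ha', Nat.cast_sub (by omega)]; push_cast; ring
    have hle : (ι z : ℝ) + w.2.val + 1 ≤ ι w := by exact_mod_cast hk
    rw [abs_of_nonneg (by linarith), ← Real.exp_add, hcast]
    congr 1; ring
  rw [sum_congr rfl hfac, ← mul_sum]
  refine mul_le_mul_of_nonneg_left ?_ (Real.exp_nonneg _)
  calc ∑ z ∈ S, Real.exp (-(r * ((a' : ℝ) - ι z)))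
      = ∑ k ∈ S.image ι, Real.exp (-(r * ((a' : ℝ) - k))) := by
        rw [sum_image fun z _ z' _ h => ι_injective h]
    _ ≤ ∑ k ∈ (range (n * B)).filter (fun k => k ≤ a'), Real.exp (-(r * ((a' : ℝ) - k))) := by
        refine sum_le_sum_of_subset_of_nonneg ?_ fun k _ _ => Real.exp_nonneg _
        intro k hk
        rw [mem_image] at hk
        obtain ⟨z, hz, rfl⟩ := hk
        rw [hS, mem_filter] at hz
        have := ι_add_le_of_blk_lt hz.2
        rw [mem_filter, mem_range]
        exact ⟨ι_lt z, by omega⟩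
    _ ≤ (1 - Real.exp (-r))⁻¹ := sum_left_exp_le hr a' (n * B)

/-- THE RIGHT OUT-OF-BLOCK TAIL: `Σ_{z : blk w < blk z} e^{−r|ι w − ι z|} ≤ e^{−r(B − o(w))}(1 − e^{−r})⁻¹`. [folklore] -/
theorem sum_blk_gt_exp_le (hr : 0 < r) (w : Fin n × Fin B) :
    ∑ z ∈ univ.filter (fun z : Fin n × Fin B => w.1 < z.1), Real.exp (-(r * |(ι w : ℝ) - ι z|))
      ≤ Real.exp (-(r * ((B : ℝ) - w.2.val))) * (1 - Real.exp (-r))⁻¹ := by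
  set S := univ.filter (fun z : Fin n × Fin B => w.1 < z.1) with hS
  set b : ℕ := ι w + (B - w.2.val) with hb
  have ho : w.2.val < B := w.2.isLt
  have hbcast : (b : ℝ) = (ι w : ℝ) + ((B : ℝ) - w.2.val) := by
    rw [hb]; push_cast; rw [Nat.cast_sub ho.le]
  have hfac : ∀ z ∈ S, Real.exp (-(r * |(ι w : ℝ) - ι z|))
      = Real.exp (-(r * ((B : ℝ) - w.2.val))) * Real.exp (-(r * ((ι z : ℝ) - b))) := by
    intro z hz
    rw [hS, mem_filter] at hz
    have hk := ι_add_le_of_blk_gt hz.2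
    have hle : (b : ℝ) ≤ ι z := by exact_mod_cast hk
    have hBo : (0 : ℝ) ≤ (B : ℝ) - w.2.val := by
      have : (w.2.val : ℝ) < B := by exact_mod_cast ho
      linarith
    rw [abs_of_nonpos (by linarith), ← Real.exp_add, hbcast]
    congr 1; ring
  rw [sum_congr rfl hfac, ← mul_sum]
  refine mul_le_mul_of_nonneg_left ?_ (Real.exp_nonneg _)
  calc ∑ z ∈ S, Real.exp (-(r * ((ι z : ℝ) - b)))
      = ∑ k ∈ S.image ι, Real.exp (-(r * ((k : ℝ) - b))) := by
        rw [sum_image fun z _ z' _ h => ι_injective h]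
    _ ≤ ∑ k ∈ (range (n * B)).filter (fun k => b ≤ k), Real.exp (-(r * ((k : ℝ) - b))) := by
        refine sum_le_sum_of_subset_of_nonneg ?_ fun k _ _ => Real.exp_nonneg _
        intro k hk
        rw [mem_image] at hk
        obtain ⟨z, hz, rfl⟩ := hk
        rw [hS, mem_filter] at hz
        have := ι_add_le_of_blk_gt hz.2
        rw [mem_filter, mem_range]
        exact ⟨ι_lt z, by omega⟩
    _ ≤ (1 - Real.exp (-r))⁻¹ := sum_right_exp_le' hr b (n * B)

/-- THE OUT-OF-BLOCK MASS of the exponential kernel at a site `w` with in-block offset `o`: the two boundary-layer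
tails `(e^{−r(o+1)} + e^{−r(B−o)})(1 − e^{−r})⁻¹` — the geometry behind the `1/a` gain of the off-diagonal part of
`E₂`. [folklore] -/
theorem sum_out_block_exp_le (hr : 0 < r) (w : Fin n × Fin B) :
    ∑ z ∈ univ.filter (fun z : Fin n × Fin B => z.1 ≠ w.1), Real.exp (-(r * |(ι w : ℝ) - ι z|))
      ≤ (Real.exp (-(r * ((w.2.val : ℝ) + 1))) + Real.exp (-(r * ((B : ℝ) - w.2.val))))
          * (1 - Real.exp (-r))⁻¹ := by
  have hsplit : univ.filter (fun z : Fin n × Fin B => z.1 ≠ w.1)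
      = univ.filter (fun z : Fin n × Fin B => z.1 < w.1) ∪ univ.filter (fun z : Fin n × Fin B => w.1 < z.1) := by
    ext z; simp only [mem_filter, mem_univ, true_and, mem_union]; exact ne_iff_lt_or_gt
  have hdisj : Disjoint (univ.filter (fun z : Fin n × Fin B => z.1 < w.1))
      (univ.filter (fun z : Fin n × Fin B => w.1 < z.1)) := by
    rw [disjoint_filter]; intro z _ h1 h2; exact lt_asymm h1 h2
  rw [hsplit, sum_union hdisj, add_mul]
  exact add_le_add (sum_blk_lt_exp_le hr w) (sum_blk_gt_exp_le hr w)

/-- THE KERNEL MASS OF A BLOCK to the right of the site: `Σ_{z∈J} e^{−r|ι w − ι z|} = e^{−r·g}·Σ_{o'<B}e^{−ro'} ≤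
e^{−r·g}(1 − e^{−r})⁻¹`, `g = (B − o(w)) + B(J − blk w − 1)` (exact geometric block sum; recorded, not used below).
[folklore] -/
theorem sum_blk_exp_le_of_gt (hr : 0 < r) (w : Fin n × Fin B) {J : Fin n} (h : w.1 < J) :
    ∑ z ∈ univ.filter (fun z : Fin n × Fin B => z.1 = J), Real.exp (-(r * |(ι w : ℝ) - ι z|))
      ≤ Real.exp (-(r * (((B : ℝ) - w.2.val) + B * ((J.val : ℝ) - w.1.val - 1)))) * (1 - Real.exp (-r))⁻¹ := by
  have ho : w.2.val < B := w.2.isLt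
  have hJ : w.1.val + 1 ≤ J.val := Nat.succ_le_of_lt (Fin.lt_def.mp h)
  rw [sum_block _ J]
  have hterm : ∀ o' : Fin B, Real.exp (-(r * |(ι w : ℝ) - ι ((J, o') : Fin n × Fin B)|))
      = Real.exp (-(r * (((B : ℝ) - w.2.val) + B * ((J.val : ℝ) - w.1.val - 1))))
        * Real.exp (-(r * (o'.val : ℝ))) := by
    intro o'
    have hk := ι_blk_gt_eq (w := w) (z := ((J, o') : Fin n × Fin B)) h
    simp only at hk
    have hcast : (ι ((J, o') : Fin n × Fin B) : ℝ)
        = (ι w : ℝ) + ((B : ℝ) - w.2.val) + (B : ℝ) * ((J.val : ℝ) - w.1.val - 1) + o'.val := by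
      rw [hk]; push_cast
      rw [Nat.cast_sub ho.le, Nat.cast_sub (by omega : 1 ≤ J.val - w.1.val),
        Nat.cast_sub (by omega : w.1.val ≤ J.val)]
      push_cast; ring
    rw [hcast, ← Real.exp_add]
    congr 1
    have hnn : (0 : ℝ) ≤ ((B : ℝ) - w.2.val) + (B : ℝ) * ((J.val : ℝ) - w.1.val - 1) + o'.val := by
      have h1 : (w.2.val : ℝ) < B := by exact_mod_cast ho
      have h2 : (w.1.val : ℝ) + 1 ≤ J.val := by exact_mod_cast hJ
      have h3 : (0 : ℝ) ≤ o'.val := Nat.cast_nonneg _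
      have h4 : (0 : ℝ) ≤ (B : ℝ) * ((J.val : ℝ) - w.1.val - 1) :=
        mul_nonneg (Nat.cast_nonneg _) (by linarith)
      linarith
    rw [abs_of_nonpos (by linarith)]
    ring
  rw [Fintype.sum_congr _ _ hterm, ← mul_sum]
  exact mul_le_mul_of_nonneg_left (sum_exp_neg_le hr) (Real.exp_nonneg _)

/-- THE KERNEL MASS OF A BLOCK to the left of the site: `Σ_{z∈J} e^{−r|ι w − ι z|} ≤ e^{−r·g}(1 − e^{−r})⁻¹`,
`g = (o(w) + 1) + B(blk w − J − 1)` (recorded, not used below). [folklore] -/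
theorem sum_blk_exp_le_of_lt (hr : 0 < r) (w : Fin n × Fin B) {J : Fin n} (h : J < w.1) :
    ∑ z ∈ univ.filter (fun z : Fin n × Fin B => z.1 = J), Real.exp (-(r * |(ι w : ℝ) - ι z|))
      ≤ Real.exp (-(r * (((w.2.val : ℝ) + 1) + B * ((w.1.val : ℝ) - J.val - 1)))) * (1 - Real.exp (-r))⁻¹ := by
  have hJ : J.val + 1 ≤ w.1.val := Nat.succ_le_of_lt (Fin.lt_def.mp h)
  rw [sum_block _ J]
  have hterm : ∀ o' : Fin B, Real.exp (-(r * |(ι w : ℝ) - ι ((J, o') : Fin n × Fin B)|))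
      = Real.exp (-(r * (((w.2.val : ℝ) + 1) + B * ((w.1.val : ℝ) - J.val - 1))))
        * Real.exp (-(r * ((B : ℝ) - 1 - o'.val))) := by
    intro o'
    have ho' : o'.val < B := o'.isLt
    have hk := ι_blk_lt_eq (w := w) (z := ((J, o') : Fin n × Fin B)) h
    simp only at hk
    have hcast : (ι w : ℝ)
        = (ι ((J, o') : Fin n × Fin B) : ℝ) + ((w.2.val : ℝ) + 1) + (B : ℝ) * ((w.1.val : ℝ) - J.val - 1)
          + ((B : ℝ) - 1 - o'.val) := by
      rw [hk]; push_cast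
      rw [Nat.cast_sub (by omega : 1 ≤ w.1.val - J.val), Nat.cast_sub (by omega : J.val ≤ w.1.val),
        Nat.sub_sub, Nat.cast_sub (by omega : 1 + o'.val ≤ B)]
      push_cast; ring
    have hnn : (0 : ℝ) ≤ ((w.2.val : ℝ) + 1) + (B : ℝ) * ((w.1.val : ℝ) - J.val - 1) + ((B : ℝ) - 1 - o'.val) := by
      have h1 : (o'.val : ℝ) + 1 ≤ B := by exact_mod_cast ho'
      have h2 : (J.val : ℝ) + 1 ≤ w.1.val := by exact_mod_cast hJ
      have h3 : (0 : ℝ) ≤ w.2.val := Nat.cast_nonneg _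
      have h4 : (0 : ℝ) ≤ (B : ℝ) * ((w.1.val : ℝ) - J.val - 1) :=
        mul_nonneg (Nat.cast_nonneg _) (by linarith)
      linarith
    rw [hcast, ← Real.exp_add]
    congr 1
    rw [abs_of_nonneg (by linarith)]
    ring
  rw [Fintype.sum_congr _ _ hterm, ← mul_sum]
  refine mul_le_mul_of_nonneg_left ?_ (Real.exp_nonneg _)
  have hrev : ∑ o' : Fin B, Real.exp (-(r * ((B : ℝ) - 1 - o'.val)))
      = ∑ o' : Fin B, Real.exp (-(r * (o'.val : ℝ))) := by
    rw [← Equiv.sum_comp Fin.revPerm (fun o' : Fin B => Real.exp (-(r * ((B : ℝ) - 1 - o'.val))))]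
    refine sum_congr rfl fun o' _ => ?_
    have ho' : o'.val < B := o'.isLt
    rw [Fin.revPerm_apply, Fin.val_rev, Nat.cast_sub (by omega)]; push_cast; ring_nf
  rw [hrev]
  exact sum_exp_neg_le hr

/-- THE BLOCK SUM OF THE BOUNDARY-LAYER TAILS: `Σ_{o<B}(e^{−r(o+1)} + e^{−r(B−o)}) ≤ 2e^{−r}(1 − e^{−r})⁻¹` — only
`O(1/r) = O(B/a)` of the `B` sites of a block see the outside. [folklore] -/
theorem sum_block_tails_le (hr : 0 < r) (I : Fin n) :
    ∑ w ∈ univ.filter (fun w : Fin n × Fin B => w.1 = I),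
        (Real.exp (-(r * ((w.2.val : ℝ) + 1))) + Real.exp (-(r * ((B : ℝ) - w.2.val))))
      ≤ 2 * Real.exp (-r) * (1 - Real.exp (-r))⁻¹ := by
  rw [sum_block (fun w : Fin n × Fin B =>
    Real.exp (-(r * ((w.2.val : ℝ) + 1))) + Real.exp (-(r * ((B : ℝ) - w.2.val)))) I]
  simp only
  rw [sum_add_distrib]
  have h1 : ∑ o : Fin B, Real.exp (-(r * ((o.val : ℝ) + 1)))
      = Real.exp (-r) * ∑ o : Fin B, Real.exp (-(r * (o.val : ℝ))) := by
    rw [mul_sum]; refine sum_congr rfl fun o _ => ?_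
    rw [← Real.exp_add]; congr 1; ring
  have h2 : ∑ o : Fin B, Real.exp (-(r * ((B : ℝ) - o.val)))
      = Real.exp (-r) * ∑ o : Fin B, Real.exp (-(r * (o.val : ℝ))) := by
    rw [← Equiv.sum_comp Fin.revPerm (fun o : Fin B => Real.exp (-(r * ((B : ℝ) - o.val))))]
    rw [mul_sum]; refine sum_congr rfl fun o _ => ?_
    rw [← Real.exp_add]; congr 1
    have ho : o.val < B := o.isLt
    rw [Fin.revPerm_apply, Fin.val_rev, Nat.cast_sub (by omega)]; push_cast; ring
  rw [h1, h2]
  have h3 := sum_exp_neg_le (B := B) hr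
  have h4 : 0 ≤ Real.exp (-r) := Real.exp_nonneg _
  nlinarith

/-- the coarse weight against the fine distance: `e^{κ·bdist(blk x, blk z)} ≤ e^{κ}·e^{(κ/B)|ι x − ι z|}` (`dι_ge`).
[folklore] -/
theorem exp_bdist_le {κ : ℝ} (hκ : 0 ≤ κ) (hB : 0 < B) (x z : Fin n × Fin B) :
    Real.exp (κ * bdist n x.1 z.1) ≤ Real.exp κ * Real.exp (κ / B * |(ι x : ℝ) - ι z|) := by
  have hBr : (0 : ℝ) < B := by exact_mod_cast hB
  have h := dι_ge x z
  have h1 : bdist n x.1 z.1 ≤ |(ι x : ℝ) - ι z| / B + 1 := by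
    rw [div_add_one hBr.ne', le_div_iff₀ hBr]; linarith
  rw [← Real.exp_add]
  refine Real.exp_le_exp.mpr ?_
  have h2 : κ * bdist n x.1 z.1 ≤ κ * (|(ι x : ℝ) - ι z| / B + 1) := mul_le_mul_of_nonneg_left h1 hκ
  have h3 : κ * (|(ι x : ℝ) - ι z| / B + 1) = κ + κ / B * |(ι x : ℝ) - ι z| := by ring
  linarith

/-- absorbing the coarse weight into the fine rate: `e^{−r|Δι|}·e^{κ·bdist} ≤ e^{κ}·e^{−(r − κ/B)|Δι|}` — at
`r = a/(2B)`, `κ = 1/2` the net rate is `(a − 1)/(2B)`. [folklore] -/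
theorem kernel_weight_le {κ : ℝ} (hκ : 0 ≤ κ) (hB : 0 < B) (r : ℝ) (x z : Fin n × Fin B) :
    Real.exp (-(r * |(ι x : ℝ) - ι z|)) * Real.exp (κ * bdist n x.1 z.1)
      ≤ Real.exp κ * Real.exp (-((r - κ / B) * |(ι x : ℝ) - ι z|)) := by
  calc Real.exp (-(r * |(ι x : ℝ) - ι z|)) * Real.exp (κ * bdist n x.1 z.1)
      ≤ Real.exp (-(r * |(ι x : ℝ) - ι z|)) * (Real.exp κ * Real.exp (κ / B * |(ι x : ℝ) - ι z|)) :=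
        mul_le_mul_of_nonneg_left (exp_bdist_le hκ hB x z) (Real.exp_nonneg _)
    _ = Real.exp κ * Real.exp (-((r - κ / B) * |(ι x : ℝ) - ι z|)) := by
        rw [mul_left_comm, ← Real.exp_add]; congr 2; ring

end Block

/-! ## §3 Row sums of `G′` at mass `m` (`μ = m²`): plain, out-of-block weighted, fully weighted -/

section Rows

variable {n B : ℕ} {m κ : ℝ}

/-- THE BLOCK POTENTIAL `u_J(w) = Σ_{z∈J} G′(w,z)` from above by the exponential kernel (from `Gr_mass_le`). [folklore] -/
theorem blockPot_le (hm0 : 0 < m) (hm1 : m ≤ 1) (w : Fin n × Fin B) (J : Fin n) :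
    ∑ z ∈ univ.filter (fun z : Fin n × Fin B => z.1 = J), Gr n B (m ^ 2) w z
      ≤ 4 / m * ∑ z ∈ univ.filter (fun z : Fin n × Fin B => z.1 = J),
          Real.exp (-(m / 2 * |(ι w : ℝ) - ι z|)) := by
  rw [mul_sum]
  exact sum_le_sum fun z _ => Gr_mass_le hm0 hm1 w z

/-- the full row sum of `G′` at mass `m`: `Σ_z G′(w,z) ≤ R₀ = (4/m)(1 + e^{−m/2})(1 − e^{−m/2})⁻¹` (`≈ 16/m²`).
[folklore] -/
theorem Gr_rowsum_le (hm0 : 0 < m) (hm1 : m ≤ 1) (w : Fin n × Fin B) :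
    ∑ z, Gr n B (m ^ 2) w z ≤ 4 / m * ((1 + Real.exp (-(m / 2))) * (1 - Real.exp (-(m / 2)))⁻¹) := by
  calc ∑ z, Gr n B (m ^ 2) w z ≤ ∑ z, 4 / m * Real.exp (-(m / 2 * |(ι w : ℝ) - ι z|)) :=
        sum_le_sum fun z _ => Gr_mass_le hm0 hm1 w z
    _ = 4 / m * ∑ z, Real.exp (-(m / 2 * |(ι w : ℝ) - ι z|)) := by rw [mul_sum]
    _ ≤ _ := mul_le_mul_of_nonneg_left (sum_line_exp_le (by linarith) w) (by positivity)

/-- THE WEIGHTED OUT-OF-BLOCK MASS at a site, pointwise: for a site `w` with offset `o`, the weighted mass of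
`G′(w,·)` OUTSIDE its block, `Σ_{z ∉ blk w} G′(w,z)e^{κ·bdist(blk w, blk z)} ≤ (4/m)e^{κ}(e^{−s(o+1)} +
e^{−s(B−o)})(1 − e^{−s})⁻¹` with the net rate `s = m/2 − κ/B > 0`. [folklore] -/
theorem out_block_weighted_le (hm0 : 0 < m) (hm1 : m ≤ 1) (hκ : 0 ≤ κ) (hB : 0 < B)
    (hs : 0 < m / 2 - κ / B) (w : Fin n × Fin B) :
    ∑ z ∈ univ.filter (fun z : Fin n × Fin B => z.1 ≠ w.1),
        Gr n B (m ^ 2) w z * Real.exp (κ * bdist n w.1 z.1)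
      ≤ 4 / m * Real.exp κ * ((Real.exp (-((m / 2 - κ / B) * ((w.2.val : ℝ) + 1)))
          + Real.exp (-((m / 2 - κ / B) * ((B : ℝ) - w.2.val)))) * (1 - Real.exp (-(m / 2 - κ / B)))⁻¹) := by
  set s := m / 2 - κ / B with hs'
  have hpt : ∀ z, Gr n B (m ^ 2) w z * Real.exp (κ * bdist n w.1 z.1)
      ≤ 4 / m * Real.exp κ * Real.exp (-(s * |(ι w : ℝ) - ι z|)) := by
    intro z
    calc Gr n B (m ^ 2) w z * Real.exp (κ * bdist n w.1 z.1)
        ≤ 4 / m * Real.exp (-(m / 2 * |(ι w : ℝ) - ι z|)) * Real.exp (κ * bdist n w.1 z.1) :=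
          mul_le_mul_of_nonneg_right (Gr_mass_le hm0 hm1 w z) (Real.exp_nonneg _)
      _ = 4 / m * (Real.exp (-(m / 2 * |(ι w : ℝ) - ι z|)) * Real.exp (κ * bdist n w.1 z.1)) := by ring
      _ ≤ 4 / m * (Real.exp κ * Real.exp (-((m / 2 - κ / B) * |(ι w : ℝ) - ι z|))) :=
          mul_le_mul_of_nonneg_left (kernel_weight_le hκ hB (m / 2) w z) (by positivity)
      _ = 4 / m * Real.exp κ * Real.exp (-(s * |(ι w : ℝ) - ι z|)) := by rw [hs']; ring
  calc ∑ z ∈ univ.filter (fun z : Fin n × Fin B => z.1 ≠ w.1), Gr n B (m ^ 2) w z * Real.exp (κ * bdist n w.1 z.1)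
      ≤ ∑ z ∈ univ.filter (fun z : Fin n × Fin B => z.1 ≠ w.1),
          4 / m * Real.exp κ * Real.exp (-(s * |(ι w : ℝ) - ι z|)) := sum_le_sum fun z _ => hpt z
    _ = 4 / m * Real.exp κ * ∑ z ∈ univ.filter (fun z : Fin n × Fin B => z.1 ≠ w.1),
          Real.exp (-(s * |(ι w : ℝ) - ι z|)) := by rw [mul_sum]
    _ ≤ _ := mul_le_mul_of_nonneg_left (sum_out_block_exp_le hs w) (by positivity)

/-- THE FULL WEIGHTED ROW SUM of `G′`: `Σ_z G′(w,z)e^{κ·bdist(blk w, blk z)} ≤ R₁ = (4/m)e^{κ}(1 + e^{−s})(1 −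
e^{−s})⁻¹`, `s = m/2 − κ/B > 0`. [folklore] -/
theorem weighted_rowsum_le (hm0 : 0 < m) (hm1 : m ≤ 1) (hκ : 0 ≤ κ) (hB : 0 < B)
    (hs : 0 < m / 2 - κ / B) (w : Fin n × Fin B) :
    ∑ z, Gr n B (m ^ 2) w z * Real.exp (κ * bdist n w.1 z.1)
      ≤ 4 / m * Real.exp κ * ((1 + Real.exp (-(m / 2 - κ / B))) * (1 - Real.exp (-(m / 2 - κ / B)))⁻¹) := by
  set s := m / 2 - κ / B with hs'
  have hpt : ∀ z, Gr n B (m ^ 2) w z * Real.exp (κ * bdist n w.1 z.1)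
      ≤ 4 / m * Real.exp κ * Real.exp (-(s * |(ι w : ℝ) - ι z|)) := by
    intro z
    calc Gr n B (m ^ 2) w z * Real.exp (κ * bdist n w.1 z.1)
        ≤ 4 / m * Real.exp (-(m / 2 * |(ι w : ℝ) - ι z|)) * Real.exp (κ * bdist n w.1 z.1) :=
          mul_le_mul_of_nonneg_right (Gr_mass_le hm0 hm1 w z) (Real.exp_nonneg _)
      _ = 4 / m * (Real.exp (-(m / 2 * |(ι w : ℝ) - ι z|)) * Real.exp (κ * bdist n w.1 z.1)) := by ring
      _ ≤ 4 / m * (Real.exp κ * Real.exp (-((m / 2 - κ / B) * |(ι w : ℝ) - ι z|))) :=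
          mul_le_mul_of_nonneg_left (kernel_weight_le hκ hB (m / 2) w z) (by positivity)
      _ = 4 / m * Real.exp κ * Real.exp (-(s * |(ι w : ℝ) - ι z|)) := by rw [hs']; ring
  calc ∑ z, Gr n B (m ^ 2) w z * Real.exp (κ * bdist n w.1 z.1)
      ≤ ∑ z, 4 / m * Real.exp κ * Real.exp (-(s * |(ι w : ℝ) - ι z|)) := sum_le_sum fun z _ => hpt z
    _ = 4 / m * Real.exp κ * ∑ z, Real.exp (-(s * |(ι w : ℝ) - ι z|)) := by rw [mul_sum]
    _ ≤ _ := mul_le_mul_of_nonneg_left (sum_line_exp_le hs w) (by positivity)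

end Rows

/-! ## §4 The off-diagonal weighted row mass of `E₂ = Q′G′²Q′*` (census §6 (a⁵), part 2) -/

section OffDiag

variable {n B : ℕ} {m κ μ s : ℝ}

/-- the plain row-sum constant `R₀(m) = (4/m)(1 + e^{−m/2})(1 − e^{−m/2})⁻¹` of `Gr_rowsum_le`. OURS (typing).
[folklore] -/
def R0 (m : ℝ) : ℝ := 4 / m * ((1 + Real.exp (-(m / 2))) * (1 - Real.exp (-(m / 2)))⁻¹)

/-- the weighted row-sum constant `R₁ = (4/m)e^{κ}(1 + e^{−s})(1 − e^{−s})⁻¹`, `s = m/2 − κ/B`, of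
`weighted_rowsum_le`. OURS (typing). [folklore] -/
def R1 (B : ℕ) (m κ : ℝ) : ℝ :=
  4 / m * Real.exp κ * ((1 + Real.exp (-(m / 2 - κ / B))) * (1 - Real.exp (-(m / 2 - κ / B)))⁻¹)

/-- the out-of-block constant `c₁ = (4/m)e^{κ}(1 − e^{−s})⁻¹` of `out_block_weighted_le`. OURS (typing). [folklore] -/
def c1 (B : ℕ) (m κ : ℝ) : ℝ := 4 / m * Real.exp κ * (1 - Real.exp (-(m / 2 - κ / B)))⁻¹

/-- the boundary-layer tails `e^{−s(o+1)} + e^{−s(B−o)}` of a site with in-block offset `o`. OURS (typing). [folklore] -/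
def btail (B : ℕ) (s : ℝ) (o : ℕ) : ℝ := Real.exp (-(s * ((o : ℝ) + 1))) + Real.exp (-(s * ((B : ℝ) - o)))

/-- the block sum of the tails, `T_L = 2e^{−s}(1 − e^{−s})⁻¹` (`sum_block_tails_le`). OURS (typing). [folklore] -/
def TL (B : ℕ) (m κ : ℝ) : ℝ := 2 * Real.exp (-(m / 2 - κ / B)) * (1 - Real.exp (-(m / 2 - κ / B)))⁻¹

/-- THE OFF-DIAGONAL BOUND `odB = B⁻¹(R₀ + R₁)·c₁·T_L` of `E2_offdiag_weighted_le`. OURS (typing). [folklore] -/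
def odB (B : ℕ) (m κ : ℝ) : ℝ := (B : ℝ)⁻¹ * ((R0 m + R1 B m κ) * (c1 B m κ * TL B m κ))

/-- the weighted out-of-block-`I` mass of the row `G′(w,·)`: `T_I(w) = Σ_{z ∉ I} G′(w,z)e^{κ|I − blk z|}`. OURS
(typing). [folklore] -/
def Tob (n B : ℕ) (μ κ : ℝ) (I : Fin n) (w : Fin n × Fin B) : ℝ :=
  ∑ z ∈ univ.filter (fun z : Fin n × Fin B => z.1 ≠ I), Gr n B μ w z * ewt n κ I z.1

/-- `1 − e^{−s} > 0` for `s > 0`. [folklore] -/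
theorem one_sub_exp_neg_pos (hs : 0 < s) : 0 < 1 - Real.exp (-s) := by
  have : Real.exp (-s) < 1 := by rw [← Real.exp_zero]; exact Real.exp_lt_exp.mpr (by linarith)
  linarith

/-- [folklore] -/
theorem R0_pos (hm0 : 0 < m) : 0 < R0 m := by
  have h := one_sub_exp_neg_pos (s := m / 2) (by linarith)
  unfold R0; positivity

/-- [folklore] -/
theorem R1_pos (hm0 : 0 < m) (hs : 0 < m / 2 - κ / B) : 0 < R1 B m κ := by
  have h := one_sub_exp_neg_pos hs
  unfold R1; positivity

/-- [folklore] -/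
theorem c1_pos (hm0 : 0 < m) (hs : 0 < m / 2 - κ / B) : 0 < c1 B m κ := by
  have h := one_sub_exp_neg_pos hs
  unfold c1; positivity

/-- [folklore] -/
theorem TL_pos (hs : 0 < m / 2 - κ / B) : 0 < TL B m κ := by
  have h := one_sub_exp_neg_pos hs
  unfold TL; positivity

/-- [folklore] -/
theorem btail_nonneg (B : ℕ) (s : ℝ) (o : ℕ) : 0 ≤ btail B s o := by unfold btail; positivity

/-- [folklore] -/
theorem odB_nonneg (hm0 : 0 < m) (hs : 0 < m / 2 - κ / B) : 0 ≤ odB B m κ := by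
  have h0 := R0_pos hm0
  have h1 := R1_pos hm0 hs
  have h2 := c1_pos hm0 hs
  have h3 := TL_pos (B := B) hs
  unfold odB; positivity

/-- `E₂ ≥ 0` entrywise (`G′ ≥ 0`). [folklore] -/
theorem E2_nonneg (hμ : 0 < μ) (I J : Fin n) : 0 ≤ E2 n B μ I J := by
  rw [E2_apply]
  refine mul_nonneg (inv_nonneg.mpr (Nat.cast_nonneg _)) (sum_nonneg fun x _ => sum_nonneg fun z _ => ?_)
  rw [Matrix.mul_apply]
  exact sum_nonneg fun w _ => mul_nonneg (Gr_nonneg hμ x w) (Gr_nonneg hμ w z)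

/-- summing over the blocks `J ≠ I` and then over the sites of `J` is summing over the sites outside `I` (finite
rearrangement). [folklore] -/
theorem sum_offblocks_eq (I : Fin n) (h : Fin n × Fin B → Fin n → ℝ) :
    ∑ J ∈ univ.filter (fun J : Fin n => J ≠ I),
        ∑ z ∈ univ.filter (fun z : Fin n × Fin B => z.1 = J), h z J
      = ∑ z ∈ univ.filter (fun z : Fin n × Fin B => z.1 ≠ I), h z z.1 := by
  rw [← sum_fiberwise_of_maps_to (s := univ.filter (fun z : Fin n × Fin B => z.1 ≠ I))
    (t := univ.filter (fun J : Fin n => J ≠ I)) (g := fun z : Fin n × Fin B => z.1)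
    (fun z hz => by simpa only [mem_filter, mem_univ, true_and] using hz) (fun z => h z z.1)]
  refine sum_congr rfl fun J hJ => ?_
  have hJI : J ≠ I := (mem_filter.mp hJ).2
  have hset : (univ.filter (fun z : Fin n × Fin B => z.1 ≠ I)).filter (fun z : Fin n × Fin B => z.1 = J)
      = univ.filter (fun z : Fin n × Fin B => z.1 = J) := by
    ext z
    simp only [mem_filter, mem_univ, true_and]
    exact ⟨fun hz => hz.2, fun hz => ⟨by rw [hz]; exact hJI, hz⟩⟩
  rw [hset]
  exact sum_congr rfl fun z hz => by rw [(mem_filter.mp hz).2]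

/-- splitting a site sum at the block `I`. [folklore] -/
theorem sum_split_block (f : Fin n × Fin B → ℝ) (I : Fin n) :
    ∑ w, f w = ∑ w ∈ univ.filter (fun w : Fin n × Fin B => w.1 = I), f w
      + ∑ w ∈ univ.filter (fun w : Fin n × Fin B => w.1 ≠ I), f w :=
  (sum_filter_add_sum_filter_not univ (fun w : Fin n × Fin B => w.1 = I) f).symm

/-- THE REARRANGEMENT: `Σ_{J≠I} E₂(I,J)e^{κ|I−J|} = B⁻¹Σ_{x∈I}Σ_w G′(x,w)·T_I(w)`. [folklore] -/
theorem E2_offdiag_weighted_eq (μ κ : ℝ) (I : Fin n) :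
    ∑ J ∈ univ.filter (fun J : Fin n => J ≠ I), E2 n B μ I J * ewt n κ I J
      = (B : ℝ)⁻¹ * ∑ x ∈ univ.filter (fun x : Fin n × Fin B => x.1 = I),
          ∑ w, Gr n B μ x w * Tob n B μ κ I w := by
  have h1 : ∀ J, E2 n B μ I J * ewt n κ I J
      = (B : ℝ)⁻¹ * ∑ x ∈ univ.filter (fun x : Fin n × Fin B => x.1 = I),
          ∑ z ∈ univ.filter (fun z : Fin n × Fin B => z.1 = J), (Gr n B μ * Gr n B μ) x z * ewt n κ I J := by
    intro J
    rw [E2_apply, mul_assoc, sum_mul]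
    congr 1
    exact sum_congr rfl fun x _ => sum_mul _ _ _
  simp_rw [h1]
  rw [← mul_sum, sum_comm (s := univ.filter (fun J : Fin n => J ≠ I))]
  congr 1
  refine sum_congr rfl fun x _ => ?_
  rw [sum_offblocks_eq I (fun z J => (Gr n B μ * Gr n B μ) x z * ewt n κ I J)]
  simp only [Tob, Matrix.mul_apply, sum_mul, mul_sum]
  rw [sum_comm]
  exact sum_congr rfl fun w _ => sum_congr rfl fun z _ => mul_assoc _ _ _

/-- `T_I(w)` for a site `w ∈ I`: the out-of-block gain, `T_I(w) ≤ c₁·(e^{−s(o(w)+1)} + e^{−s(B−o(w))})`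
(`out_block_weighted_le`). [folklore] -/
theorem Tob_in_le (hm0 : 0 < m) (hm1 : m ≤ 1) (hκ : 0 ≤ κ) (hB : 0 < B) (hs : 0 < m / 2 - κ / B)
    {I : Fin n} {w : Fin n × Fin B} (hw : w.1 = I) :
    Tob n B (m ^ 2) κ I w ≤ c1 B m κ * btail B (m / 2 - κ / B) w.2.val := by
  have h := out_block_weighted_le hm0 hm1 hκ hB hs w
  rw [hw] at h
  unfold Tob c1 btail ewt
  refine h.trans (le_of_eq ?_)
  ring

/-- `T_I(w)` for any site: the triangle inequality of the weight and the full weighted row sum, `T_I(w) ≤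
e^{κ|I − blk w|}·R₁`. [folklore] -/
theorem Tob_le (hm0 : 0 < m) (hm1 : m ≤ 1) (hκ : 0 ≤ κ) (hB : 0 < B) (hs : 0 < m / 2 - κ / B)
    (I : Fin n) (w : Fin n × Fin B) :
    Tob n B (m ^ 2) κ I w ≤ ewt n κ I w.1 * R1 B m κ := by
  have hμ : 0 < m ^ 2 := by positivity
  have hW := isWt_ewt (n := n) hκ
  unfold Tob R1
  calc ∑ z ∈ univ.filter (fun z : Fin n × Fin B => z.1 ≠ I), Gr n B (m ^ 2) w z * ewt n κ I z.1
      ≤ ∑ z, Gr n B (m ^ 2) w z * ewt n κ I z.1 :=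
        sum_le_sum_of_subset_of_nonneg (filter_subset _ _) fun z _ _ =>
          mul_nonneg (Gr_nonneg hμ w z) (hW.nonneg I z.1)
    _ ≤ ∑ z, Gr n B (m ^ 2) w z * (ewt n κ I w.1 * ewt n κ w.1 z.1) :=
        sum_le_sum fun z _ => mul_le_mul_of_nonneg_left (hW.tri I w.1 z.1) (Gr_nonneg hμ w z)
    _ = ewt n κ I w.1 * ∑ z, Gr n B (m ^ 2) w z * Real.exp (κ * bdist n w.1 z.1) := by
        rw [mul_sum]
        refine sum_congr rfl fun z _ => ?_
        simp only [ewt]; ring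
    _ ≤ _ := mul_le_mul_of_nonneg_left (weighted_rowsum_le hm0 hm1 hκ hB hs w) (hW.nonneg I w.1)

/-- the in-block COLUMN sums of `G′` from above, by symmetry: `Σ_{x∈I} G′(x,w) ≤ R₀`. [folklore] -/
theorem Gr_block_colsum_le (hm0 : 0 < m) (hm1 : m ≤ 1) (I : Fin n) (w : Fin n × Fin B) :
    ∑ x ∈ univ.filter (fun x : Fin n × Fin B => x.1 = I), Gr n B (m ^ 2) x w ≤ R0 m := by
  have hμ : 0 < m ^ 2 := by positivity
  unfold R0
  calc ∑ x ∈ univ.filter (fun x : Fin n × Fin B => x.1 = I), Gr n B (m ^ 2) x w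
      = ∑ x ∈ univ.filter (fun x : Fin n × Fin B => x.1 = I), Gr n B (m ^ 2) w x :=
        sum_congr rfl fun x _ => Gr_symm _ x w
    _ ≤ ∑ x, Gr n B (m ^ 2) w x :=
        sum_le_sum_of_subset_of_nonneg (filter_subset _ _) fun x _ _ => Gr_nonneg hμ w x
    _ ≤ _ := Gr_rowsum_le hm0 hm1 w

/-- the block sum of the tails in the `btail` notation. [folklore] -/
theorem sum_btail_le (hs : 0 < s) (I : Fin n) :
    ∑ w ∈ univ.filter (fun w : Fin n × Fin B => w.1 = I), btail B s w.2.val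
      ≤ 2 * Real.exp (-s) * (1 - Real.exp (-s))⁻¹ := by
  unfold btail
  exact sum_block_tails_le hs I

/-- **THE OFF-DIAGONAL WEIGHTED ROW MASS OF `E₂`** (census §6 (a⁵), second half, part 2): at `μ = m²`, `0 < m ≤ 1`,
`0 ≤ κ`, `s = m/2 − κ/B > 0`, for every coarse block `I`,
`Σ_{J≠I} E₂(I,J)·e^{κ|I−J|} ≤ odB = B⁻¹(R₀ + R₁)·c₁·T_L`. [folklore] -/
theorem E2_offdiag_weighted_le (hm0 : 0 < m) (hm1 : m ≤ 1) (hκ : 0 ≤ κ) (hB : 0 < B)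
    (hs : 0 < m / 2 - κ / B) (I : Fin n) :
    ∑ J ∈ univ.filter (fun J : Fin n => J ≠ I), E2 n B (m ^ 2) I J * ewt n κ I J ≤ odB B m κ := by
  have hμ : 0 < m ^ 2 := by positivity
  have hG0 : ∀ x w, 0 ≤ Gr n B (m ^ 2) x w := Gr_nonneg hμ
  have hc1 : 0 ≤ c1 B m κ := (c1_pos hm0 hs).le
  have hR1 : 0 ≤ R1 B m κ := (R1_pos hm0 hs).le
  have hR0 : 0 ≤ R0 m := (R0_pos hm0).le
  have hbt : ∀ w : Fin n × Fin B, 0 ≤ btail B (m / 2 - κ / B) w.2.val := fun w => btail_nonneg _ _ _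
  have hTin : ∀ w ∈ univ.filter (fun w : Fin n × Fin B => w.1 = I),
      Tob n B (m ^ 2) κ I w ≤ c1 B m κ * btail B (m / 2 - κ / B) w.2.val :=
    fun w hw => Tob_in_le hm0 hm1 hκ hB hs (mem_filter.mp hw).2
  have hTout : ∀ w, Tob n B (m ^ 2) κ I w ≤ ewt n κ I w.1 * R1 B m κ :=
    fun w => Tob_le hm0 hm1 hκ hB hs I w
  have htails : ∑ w ∈ univ.filter (fun w : Fin n × Fin B => w.1 = I), btail B (m / 2 - κ / B) w.2.val
      ≤ TL B m κ := by
    unfold TL; exact sum_btail_le hs I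
  -- the out-of-block weighted mass of the row of a site `x ∈ I` is `T_I(x)`
  have hxout : ∀ x ∈ univ.filter (fun x : Fin n × Fin B => x.1 = I),
      ∑ w ∈ univ.filter (fun w : Fin n × Fin B => w.1 ≠ I), Gr n B (m ^ 2) x w * ewt n κ I w.1
        ≤ c1 B m κ * btail B (m / 2 - κ / B) x.2.val :=
    fun x hx => Tob_in_le hm0 hm1 hκ hB hs (mem_filter.mp hx).2
  rw [E2_offdiag_weighted_eq, odB]
  refine mul_le_mul_of_nonneg_left ?_ (inv_nonneg.mpr (Nat.cast_nonneg _))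
  -- sites `w ∈ I`
  have piece1 : ∑ x ∈ univ.filter (fun x : Fin n × Fin B => x.1 = I),
      ∑ w ∈ univ.filter (fun w : Fin n × Fin B => w.1 = I), Gr n B (m ^ 2) x w * Tob n B (m ^ 2) κ I w
        ≤ R0 m * (c1 B m κ * TL B m κ) := by
    calc ∑ x ∈ univ.filter (fun x : Fin n × Fin B => x.1 = I),
          ∑ w ∈ univ.filter (fun w : Fin n × Fin B => w.1 = I), Gr n B (m ^ 2) x w * Tob n B (m ^ 2) κ I w
        ≤ ∑ x ∈ univ.filter (fun x : Fin n × Fin B => x.1 = I),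
            ∑ w ∈ univ.filter (fun w : Fin n × Fin B => w.1 = I),
              Gr n B (m ^ 2) x w * (c1 B m κ * btail B (m / 2 - κ / B) w.2.val) :=
          sum_le_sum fun x _ => sum_le_sum fun w hw => mul_le_mul_of_nonneg_left (hTin w hw) (hG0 x w)
      _ = ∑ w ∈ univ.filter (fun w : Fin n × Fin B => w.1 = I),
            (∑ x ∈ univ.filter (fun x : Fin n × Fin B => x.1 = I), Gr n B (m ^ 2) x w)
              * (c1 B m κ * btail B (m / 2 - κ / B) w.2.val) := by
          rw [sum_comm]
          exact sum_congr rfl fun w _ => (sum_mul _ _ _).symm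
      _ ≤ ∑ w ∈ univ.filter (fun w : Fin n × Fin B => w.1 = I),
            R0 m * (c1 B m κ * btail B (m / 2 - κ / B) w.2.val) :=
          sum_le_sum fun w _ => mul_le_mul_of_nonneg_right (Gr_block_colsum_le hm0 hm1 I w)
            (mul_nonneg hc1 (hbt w))
      _ = R0 m * (c1 B m κ * ∑ w ∈ univ.filter (fun w : Fin n × Fin B => w.1 = I),
            btail B (m / 2 - κ / B) w.2.val) := by
          rw [mul_sum, mul_sum]
      _ ≤ R0 m * (c1 B m κ * TL B m κ) :=
          mul_le_mul_of_nonneg_left (mul_le_mul_of_nonneg_left htails hc1) hR0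
  -- sites `w ∉ I`
  have piece2 : ∑ x ∈ univ.filter (fun x : Fin n × Fin B => x.1 = I),
      ∑ w ∈ univ.filter (fun w : Fin n × Fin B => w.1 ≠ I), Gr n B (m ^ 2) x w * Tob n B (m ^ 2) κ I w
        ≤ R1 B m κ * (c1 B m κ * TL B m κ) := by
    calc ∑ x ∈ univ.filter (fun x : Fin n × Fin B => x.1 = I),
          ∑ w ∈ univ.filter (fun w : Fin n × Fin B => w.1 ≠ I), Gr n B (m ^ 2) x w * Tob n B (m ^ 2) κ I w
        ≤ ∑ x ∈ univ.filter (fun x : Fin n × Fin B => x.1 = I),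
            ∑ w ∈ univ.filter (fun w : Fin n × Fin B => w.1 ≠ I),
              Gr n B (m ^ 2) x w * (ewt n κ I w.1 * R1 B m κ) :=
          sum_le_sum fun x _ => sum_le_sum fun w _ => mul_le_mul_of_nonneg_left (hTout w) (hG0 x w)
      _ = ∑ x ∈ univ.filter (fun x : Fin n × Fin B => x.1 = I),
            (∑ w ∈ univ.filter (fun w : Fin n × Fin B => w.1 ≠ I), Gr n B (m ^ 2) x w * ewt n κ I w.1)
              * R1 B m κ := by
          refine sum_congr rfl fun x _ => ?_
          rw [sum_mul]
          exact sum_congr rfl fun w _ => (mul_assoc _ _ _).symm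
      _ ≤ ∑ x ∈ univ.filter (fun x : Fin n × Fin B => x.1 = I),
            (c1 B m κ * btail B (m / 2 - κ / B) x.2.val) * R1 B m κ :=
          sum_le_sum fun x hx => mul_le_mul_of_nonneg_right (hxout x hx) hR1
      _ = R1 B m κ * (c1 B m κ * ∑ x ∈ univ.filter (fun x : Fin n × Fin B => x.1 = I),
            btail B (m / 2 - κ / B) x.2.val) := by
          rw [mul_sum, mul_sum]
          exact sum_congr rfl fun x _ => by ring
      _ ≤ R1 B m κ * (c1 B m κ * TL B m κ) :=
          mul_le_mul_of_nonneg_left (mul_le_mul_of_nonneg_left htails hc1) hR1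
  calc ∑ x ∈ univ.filter (fun x : Fin n × Fin B => x.1 = I), ∑ w, Gr n B (m ^ 2) x w * Tob n B (m ^ 2) κ I w
      = ∑ x ∈ univ.filter (fun x : Fin n × Fin B => x.1 = I),
          (∑ w ∈ univ.filter (fun w : Fin n × Fin B => w.1 = I), Gr n B (m ^ 2) x w * Tob n B (m ^ 2) κ I w
            + ∑ w ∈ univ.filter (fun w : Fin n × Fin B => w.1 ≠ I), Gr n B (m ^ 2) x w * Tob n B (m ^ 2) κ I w) :=
        sum_congr rfl fun x _ => sum_split_block _ I
    _ = ∑ x ∈ univ.filter (fun x : Fin n × Fin B => x.1 = I),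
          ∑ w ∈ univ.filter (fun w : Fin n × Fin B => w.1 = I), Gr n B (m ^ 2) x w * Tob n B (m ^ 2) κ I w
        + ∑ x ∈ univ.filter (fun x : Fin n × Fin B => x.1 = I),
          ∑ w ∈ univ.filter (fun w : Fin n × Fin B => w.1 ≠ I), Gr n B (m ^ 2) x w * Tob n B (m ^ 2) κ I w :=
        sum_add_distrib
    _ ≤ R0 m * (c1 B m κ * TL B m κ) + R1 B m κ * (c1 B m κ * TL B m κ) := add_le_add piece1 piece2
    _ = (R0 m + R1 B m κ) * (c1 B m κ * TL B m κ) := by ring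

end OffDiag

/-! ## §5 The assembly: weighted diagonal dominance ⇒ `E₂` invertible, `E₂⁻¹ ∈ 𝒟(0, −4, c)` (census §6 (a⁵), part 3) -/

section Assembly

variable {n B : ℕ} {N : Finset (Fin n)} {hN : N.Nonempty} {δ₀ : ℝ} {m κ : ℝ}

/-- FROM THE OFF-DIAGONAL MASS TO THE ENGINE'S HYPOTHESIS, generically: for an entrywise non-negative `E` with
diagonal `E(i,i) ≥ d > 0` and off-diagonal weighted row mass `Σ_{j≠i} E(i,j)w(i,j) ≤ Ω`, the weighted rows of
`1 − diag(E(i,i))⁻¹·E` are `≤ Ω/d` (its diagonal vanishes). [folklore] -/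
theorem rowLe_of_offdiag {α : Type*} [Fintype α] [DecidableEq α] {w : α → α → ℝ} (hw : IsWt w)
    {E : Matrix α α ℝ} {d Ω : ℝ} (hE : ∀ i j, 0 ≤ E i j) (hd : 0 < d) (hD : ∀ i, d ≤ E i i)
    (hΩ : ∀ i, ∑ j ∈ univ.filter (fun j => j ≠ i), E i j * w i j ≤ Ω) :
    RowLe w (1 - Matrix.diagonal (fun i => (E i i)⁻¹) * E) (Ω / d) := by
  intro i
  have hEi : 0 < E i i := lt_of_lt_of_le hd (hD i)
  have hM : ∀ j, (1 - Matrix.diagonal (fun i => (E i i)⁻¹) * E) i j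
      = (if i = j then 1 else 0) - (E i i)⁻¹ * E i j := by
    intro j
    rw [Matrix.sub_apply, Matrix.one_apply, Matrix.diagonal_mul]
  have hMi : (1 - Matrix.diagonal (fun i => (E i i)⁻¹) * E) i i = 0 := by
    rw [hM, if_pos rfl, inv_mul_cancel₀ hEi.ne', sub_self]
  have hMj : ∀ j, j ≠ i → |(1 - Matrix.diagonal (fun i => (E i i)⁻¹) * E) i j| = (E i i)⁻¹ * E i j := by
    intro j hj
    rw [hM, if_neg (Ne.symm hj), zero_sub, abs_neg, abs_of_nonneg (mul_nonneg (inv_nonneg.mpr hEi.le) (hE i j))]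
  rw [← add_sum_erase univ _ (mem_univ i), hMi, abs_zero, zero_mul, zero_add, ← filter_ne']
  calc ∑ j ∈ univ.filter (fun j => j ≠ i), |(1 - Matrix.diagonal (fun i => (E i i)⁻¹) * E) i j| * w i j
      = ∑ j ∈ univ.filter (fun j => j ≠ i), (E i i)⁻¹ * (E i j * w i j) := by
        refine sum_congr rfl fun j hj => ?_
        rw [hMj j (mem_filter.mp hj).2, mul_assoc]
    _ = (E i i)⁻¹ * ∑ j ∈ univ.filter (fun j => j ≠ i), E i j * w i j := by rw [mul_sum]
    _ ≤ d⁻¹ * Ω := mul_le_mul (inv_anti₀ hd (hD i)) (hΩ i)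
        (sum_nonneg fun j _ => mul_nonneg (hE i j) (hw.nonneg i j)) (inv_nonneg.mpr hd.le)
    _ = Ω / d := by rw [div_eq_inv_mul]

/-- monotonicity of the weighted row bound in the bound. [folklore] -/
theorem rowLe_mono {α : Type*} [Fintype α] {w : α → α → ℝ} {M : Matrix α α ℝ} {q q' : ℝ}
    (hM : RowLe w M q) (hq : q ≤ q') : RowLe w M q' :=
  fun i => (hM i).trans hq

/-- **`E₂` IS INVERTIBLE WITH EXPONENTIALLY WEIGHTED ROW BOUNDS FOR `E₂⁻¹`** (parametric form): at `μ = m²`,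
`0 < m ≤ 1`, `0 ≤ κ`, `m/2 − κ/B > 0`, if the diagonal dominates, `E₂(I,I) ≥ d > 0` with `odB/d < 1`, then
`IsUnit E₂` and `Σ_J |E₂⁻¹(I,J)|e^{κ|I−J|} ≤ (1 − odB/d)⁻¹d⁻¹` (Toy6's `RowLe.inv_of_diag` on `rowLe_of_offdiag` and
`E2_offdiag_weighted_le`). [folklore] -/
theorem isUnit_E2_inv_rowLe (hm0 : 0 < m) (hm1 : m ≤ 1) (hκ : 0 ≤ κ) (hB : 0 < B) (hs : 0 < m / 2 - κ / B)
    {d : ℝ} (hd : 0 < d) (hD : ∀ I : Fin n, d ≤ E2 n B (m ^ 2) I I) (hq : odB B m κ / d < 1) :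
    IsUnit (E2 n B (m ^ 2)) ∧ RowLe (ewt n κ) (E2 n B (m ^ 2))⁻¹ ((1 - odB B m κ / d)⁻¹ * d⁻¹) :=
  RowLe.inv_of_diag (isWt_ewt hκ) (D := fun I => E2 n B (m ^ 2) I I) hd hD hq
    (rowLe_of_offdiag (isWt_ewt hκ) (E2_nonneg (by positivity)) hd hD
      fun I => E2_offdiag_weighted_le hm0 hm1 hκ hB hs I)

/-- **THE COARSE INVERSE IN ITS CLASS** (parametric form): with `2·odB ≤ d ≤ E₂(I,I)` (dominance by a factor two)
and `2d⁻¹ ≤ c·B⁻⁴`, `0 ≤ κ`, `δ₀ ≤ κ`: `E₂⁻¹ ∈ 𝒟(0, −4, c)` on the toy frame (`opDec_coarse_of_rowLe`) — the SHAPE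
`MOne.mC`. [folklore] -/
theorem E2_inv_opDec (hm0 : 0 < m) (hm1 : m ≤ 1) (hκ : 0 ≤ κ) (hB : 0 < B) (hs : 0 < m / 2 - κ / B)
    (hδ : δ₀ ≤ κ) {d c : ℝ} (hd : 0 < d) (hD : ∀ I : Fin n, d ≤ E2 n B (m ^ 2) I I)
    (h2 : 2 * odB B m κ ≤ d) (hc : 2 * d⁻¹ ≤ c * (B : ℝ) ^ (-4 : ℤ)) :
    OpDec (toyFrame n B N hN δ₀) id id id id 0 (-4) c (E2 n B (m ^ 2))⁻¹ := by
  have hod : 0 ≤ odB B m κ := odB_nonneg hm0 hs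
  have hq : odB B m κ / d ≤ 1 / 2 := by
    rw [div_le_iff₀ hd]; linarith
  obtain ⟨-, hR⟩ := isUnit_E2_inv_rowLe hm0 hm1 hκ hB hs hd hD (by linarith)
  have hfac : (1 - odB B m κ / d)⁻¹ ≤ 2 := by
    rw [inv_le_comm₀ (by linarith) (by norm_num)]
    linarith
  have hR' : RowLe (ewt n κ) (E2 n B (m ^ 2))⁻¹ (2 * d⁻¹) :=
    rowLe_mono hR (mul_le_mul_of_nonneg_right hfac (inv_nonneg.mpr hd.le))
  have hB4 : (0 : ℝ) < (B : ℝ) ^ (-4 : ℤ) := zpow_pos (by exact_mod_cast hB) _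
  have hc0 : 0 ≤ c := by
    refine le_of_mul_le_mul_right ?_ hB4
    rw [zero_mul]
    exact le_trans (by positivity) hc
  exact opDec_coarse_of_rowLe hκ hδ hR' hc0 hc

end Assembly

/-! ## §6 The numeric corollary: `κ = 1/2`, `μ = (a/B)²`, `16384 ≤ a ≤ B` ⇒ `E₂⁻¹ ∈ 𝒟(0, −4, 3a⁴)` -/

section Numeric

variable {n B : ℕ} {N : Finset (Fin n)} {hN : N.Nonempty} {δ₀ : ℝ} {a r : ℝ}

/-- the geometric factor: `(1 − e^{−r})⁻¹ ≤ 1 + 1/r` (`e^{r} ≥ 1 + r`). [folklore] -/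
theorem inv_one_sub_exp_le (hr : 0 < r) : (1 - Real.exp (-r))⁻¹ ≤ 1 + r⁻¹ := by
  have h1 : r + 1 ≤ Real.exp r := Real.add_one_le_exp r
  have h2 : Real.exp (-r) * Real.exp r = 1 := by rw [← Real.exp_add, neg_add_cancel, Real.exp_zero]
  have h3 : 0 < Real.exp (-r) := Real.exp_pos _
  have h4 : Real.exp (-r) * (r + 1) ≤ 1 := by nlinarith
  have h6 : 0 < 1 - Real.exp (-r) := one_sub_exp_neg_pos hr
  have key : 1 ≤ (1 - Real.exp (-r)) * (1 + r⁻¹) := by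
    have e : (1 - Real.exp (-r)) * (1 + r⁻¹) = (r + 1 - Real.exp (-r) * (r + 1)) / r := by
      field_simp
    rw [e, le_div_iff₀ hr]
    linarith
  calc (1 - Real.exp (-r))⁻¹ = (1 - Real.exp (-r))⁻¹ * 1 := (mul_one _).symm
    _ ≤ (1 - Real.exp (-r))⁻¹ * ((1 - Real.exp (-r)) * (1 + r⁻¹)) :=
        mul_le_mul_of_nonneg_left key (inv_nonneg.mpr h6.le)
    _ = 1 + r⁻¹ := by rw [← mul_assoc, inv_mul_cancel₀ h6.ne', one_mul]

/-- `e^{1/2} ≤ 5/3` (`e < 2.7182818286 < 25/9`). [folklore] -/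
theorem exp_half_le : Real.exp (1 / 2) ≤ 5 / 3 := by
  have h := Real.exp_one_lt_d9
  have h2 : Real.exp (1 / 2) * Real.exp (1 / 2) = Real.exp 1 := by rw [← Real.exp_add]; norm_num
  nlinarith [Real.exp_pos (1 / 2)]

/-- the in-block geometric factor at `t = a/(2B)`: `(1 − e^{−a/(2B)})⁻¹ ≤ 3B/a` for `0 < a ≤ B`. [folklore] -/
theorem geomfac_t_le (ha : 0 < a) (haB : a ≤ (B : ℝ)) : (1 - Real.exp (-(a / B / 2)))⁻¹ ≤ 3 * B / a := by
  have hBr : (0 : ℝ) < B := lt_of_lt_of_le ha haB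
  calc (1 - Real.exp (-(a / B / 2)))⁻¹ ≤ 1 + (a / B / 2)⁻¹ := inv_one_sub_exp_le (by positivity)
    _ = (a + 2 * B) / a := by field_simp
    _ ≤ 3 * B / a := div_le_div_of_nonneg_right (by linarith) ha.le

/-- the net rate at `κ = 1/2`, `m = a/B`: `s = m/2 − κ/B = (a − 1)/(2B)`. [folklore] -/
theorem srate_eq (a : ℝ) (B : ℕ) : a / B / 2 - 1 / 2 / (B : ℝ) = (a - 1) / B / 2 := by ring

/-- the out-of-block geometric factor at `s = (a−1)/(2B)`: `(1 − e^{−s})⁻¹ ≤ 3B/(a − 1)` for `1 < a ≤ B`. [folklore] -/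
theorem geomfac_s_le (ha : 1 < a) (haB : a ≤ (B : ℝ)) :
    (1 - Real.exp (-(a / B / 2 - 1 / 2 / (B : ℝ))))⁻¹ ≤ 3 * B / (a - 1) := by
  have hBr : (0 : ℝ) < B := by linarith
  have ha1 : 0 < a - 1 := by linarith
  rw [srate_eq]
  calc (1 - Real.exp (-((a - 1) / B / 2)))⁻¹ ≤ 1 + ((a - 1) / B / 2)⁻¹ := inv_one_sub_exp_le (by positivity)
    _ = (a - 1 + 2 * B) / (a - 1) := by field_simp
    _ ≤ 3 * B / (a - 1) := div_le_div_of_nonneg_right (by linarith) ha1.le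

/-- `R₀(a/B) ≤ 24B²/a²` for `0 < a ≤ B`. [folklore] -/
theorem R0_num_le (ha : 0 < a) (haB : a ≤ (B : ℝ)) : R0 (a / B) ≤ 24 * (B : ℝ) ^ 2 / a ^ 2 := by
  have hBr : (0 : ℝ) < B := lt_of_lt_of_le ha haB
  have h1 : 1 + Real.exp (-(a / B / 2)) ≤ 2 := by
    have : Real.exp (-(a / B / 2)) ≤ 1 := Real.exp_le_one_iff.mpr (by
      have : 0 < a / B / 2 := by positivity
      linarith)
    linarith
  have h2 := geomfac_t_le ha haB
  have h3 : 0 ≤ (1 - Real.exp (-(a / B / 2)))⁻¹ :=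
    inv_nonneg.mpr (one_sub_exp_neg_pos (s := a / B / 2) (by positivity)).le
  unfold R0
  calc 4 / (a / B) * ((1 + Real.exp (-(a / B / 2))) * (1 - Real.exp (-(a / B / 2)))⁻¹)
      ≤ 4 / (a / B) * (2 * (3 * B / a)) :=
        mul_le_mul_of_nonneg_left (mul_le_mul h1 h2 h3 zero_le_two) (by positivity)
    _ = 24 * (B : ℝ) ^ 2 / a ^ 2 := by field_simp; ring

/-- `R₁ ≤ 40B²/(a(a−1))` at `κ = 1/2`, `m = a/B`, `1 < a ≤ B`. [folklore] -/
theorem R1_num_le (ha : 1 < a) (haB : a ≤ (B : ℝ)) :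
    R1 B (a / B) (1 / 2) ≤ 40 * (B : ℝ) ^ 2 / (a * (a - 1)) := by
  have ha0 : 0 < a := by linarith
  have hBr : (0 : ℝ) < B := by linarith
  have ha1 : 0 < a - 1 := by linarith
  have hs : 0 < a / B / 2 - 1 / 2 / (B : ℝ) := by rw [srate_eq]; positivity
  have h1 : 1 + Real.exp (-(a / B / 2 - 1 / 2 / (B : ℝ))) ≤ 2 := by
    have : Real.exp (-(a / B / 2 - 1 / 2 / (B : ℝ))) ≤ 1 := Real.exp_le_one_iff.mpr (by linarith)
    linarith
  have h2 := geomfac_s_le ha haB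
  have h3 : 0 ≤ (1 - Real.exp (-(a / B / 2 - 1 / 2 / (B : ℝ))))⁻¹ :=
    inv_nonneg.mpr (one_sub_exp_neg_pos hs).le
  unfold R1
  calc 4 / (a / B) * Real.exp (1 / 2) * ((1 + Real.exp (-(a / B / 2 - 1 / 2 / (B : ℝ))))
        * (1 - Real.exp (-(a / B / 2 - 1 / 2 / (B : ℝ))))⁻¹)
      ≤ 4 / (a / B) * (5 / 3) * (2 * (3 * B / (a - 1))) :=
        mul_le_mul (mul_le_mul_of_nonneg_left exp_half_le (by positivity)) (mul_le_mul h1 h2 h3 zero_le_two)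
          (by positivity) (by positivity)
    _ = 40 * (B : ℝ) ^ 2 / (a * (a - 1)) := by field_simp; ring

/-- `c₁ ≤ 20B²/(a(a−1))` at `κ = 1/2`, `m = a/B`, `1 < a ≤ B`. [folklore] -/
theorem c1_num_le (ha : 1 < a) (haB : a ≤ (B : ℝ)) :
    c1 B (a / B) (1 / 2) ≤ 20 * (B : ℝ) ^ 2 / (a * (a - 1)) := by
  have ha0 : 0 < a := by linarith
  have hBr : (0 : ℝ) < B := by linarith
  have ha1 : 0 < a - 1 := by linarith
  have hs : 0 < a / B / 2 - 1 / 2 / (B : ℝ) := by rw [srate_eq]; positivity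
  have h2 := geomfac_s_le ha haB
  have h3 : 0 ≤ (1 - Real.exp (-(a / B / 2 - 1 / 2 / (B : ℝ))))⁻¹ :=
    inv_nonneg.mpr (one_sub_exp_neg_pos hs).le
  unfold c1
  calc 4 / (a / B) * Real.exp (1 / 2) * (1 - Real.exp (-(a / B / 2 - 1 / 2 / (B : ℝ))))⁻¹
      ≤ 4 / (a / B) * (5 / 3) * (3 * B / (a - 1)) :=
        mul_le_mul (mul_le_mul_of_nonneg_left exp_half_le (by positivity)) h2 h3 (by positivity)
    _ = 20 * (B : ℝ) ^ 2 / (a * (a - 1)) := by field_simp; ring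

/-- `T_L ≤ 6B/(a−1)` at `κ = 1/2`, `m = a/B`, `1 < a ≤ B`. [folklore] -/
theorem TL_num_le (ha : 1 < a) (haB : a ≤ (B : ℝ)) : TL B (a / B) (1 / 2) ≤ 6 * B / (a - 1) := by
  have hBr : (0 : ℝ) < B := by linarith
  have ha1 : 0 < a - 1 := by linarith
  have hs : 0 < a / B / 2 - 1 / 2 / (B : ℝ) := by rw [srate_eq]; positivity
  have h1 : Real.exp (-(a / B / 2 - 1 / 2 / (B : ℝ))) ≤ 1 := Real.exp_le_one_iff.mpr (by linarith)
  have h2 := geomfac_s_le ha haB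
  have h3 : 0 ≤ (1 - Real.exp (-(a / B / 2 - 1 / 2 / (B : ℝ))))⁻¹ :=
    inv_nonneg.mpr (one_sub_exp_neg_pos hs).le
  unfold TL
  calc 2 * Real.exp (-(a / B / 2 - 1 / 2 / (B : ℝ))) * (1 - Real.exp (-(a / B / 2 - 1 / 2 / (B : ℝ))))⁻¹
      ≤ 2 * 1 * (3 * B / (a - 1)) :=
        mul_le_mul (mul_le_mul_of_nonneg_left h1 zero_le_two) h2 h3 (by positivity)
    _ = 6 * B / (a - 1) := by ring

/-- **THE OFF-DIAGONAL MASS, NUMERICALLY**: `odB ≤ 7680·B⁴/(a²(a−1)³)` at `κ = 1/2`, `m = a/B`, `1 < a ≤ B` — of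
relative size `O(1/a)` against the diagonal `≍ B⁴/a⁴`. [folklore] -/
theorem odB_num_le (ha : 1 < a) (haB : a ≤ (B : ℝ)) :
    odB B (a / B) (1 / 2) ≤ 7680 * (B : ℝ) ^ 4 / (a ^ 2 * (a - 1) ^ 3) := by
  have ha0 : 0 < a := by linarith
  have hBr : (0 : ℝ) < B := by linarith
  have ha1 : 0 < a - 1 := by linarith
  have ha1' : a - 1 ≠ 0 := ha1.ne'
  have hs : 0 < a / B / 2 - 1 / 2 / (B : ℝ) := by rw [srate_eq]; positivity
  have hR0 := R0_num_le ha0 haB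
  have hR1 := R1_num_le ha haB
  have hc1 := c1_num_le ha haB
  have hTL := TL_num_le ha haB
  have hR0' : R0 (a / B) ≤ 24 * (B : ℝ) ^ 2 / (a * (a - 1)) := by
    refine hR0.trans (div_le_div_of_nonneg_left (by positivity) (by positivity) ?_)
    nlinarith
  have hsum : R0 (a / B) + R1 B (a / B) (1 / 2) ≤ 64 * (B : ℝ) ^ 2 / (a * (a - 1)) := by
    have : 24 * (B : ℝ) ^ 2 / (a * (a - 1)) + 40 * (B : ℝ) ^ 2 / (a * (a - 1))
        = 64 * (B : ℝ) ^ 2 / (a * (a - 1)) := by ring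
    linarith
  have hprod : c1 B (a / B) (1 / 2) * TL B (a / B) (1 / 2) ≤ 120 * (B : ℝ) ^ 3 / (a * (a - 1) ^ 2) := by
    calc c1 B (a / B) (1 / 2) * TL B (a / B) (1 / 2)
        ≤ (20 * (B : ℝ) ^ 2 / (a * (a - 1))) * (6 * B / (a - 1)) :=
          mul_le_mul hc1 hTL (TL_pos hs).le (by positivity)
      _ = 120 * (B : ℝ) ^ 3 / (a * (a - 1) ^ 2) := by field_simp; ring
  have hct : 0 ≤ c1 B (a / B) (1 / 2) * TL B (a / B) (1 / 2) :=
    mul_nonneg (c1_pos (by positivity) hs).le (TL_pos hs).le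
  unfold odB
  calc (B : ℝ)⁻¹ * ((R0 (a / B) + R1 B (a / B) (1 / 2)) * (c1 B (a / B) (1 / 2) * TL B (a / B) (1 / 2)))
      ≤ (B : ℝ)⁻¹ * ((64 * (B : ℝ) ^ 2 / (a * (a - 1))) * (120 * (B : ℝ) ^ 3 / (a * (a - 1) ^ 2))) :=
        mul_le_mul_of_nonneg_left (mul_le_mul hsum hprod hct (by positivity)) (inv_nonneg.mpr hBr.le)
    _ = 7680 * (B : ℝ) ^ 4 / (a ^ 2 * (a - 1) ^ 3) := by field_simp; ring

/-- **THE DIAGONAL, NUMERICALLY**: `E₂(I,I) ≥ B⁴(a−6)²/a⁶` at `μ = (a/B)²`, `6 ≤ a ≤ B` (Toy6's `E2_diag_ge` with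
`t = a/(2B)`, `cosh_half_le`, `(1 − e^{−t})⁻¹ ≤ 3B/a`). [folklore] -/
theorem E2_diag_ge_num (ha : 6 ≤ a) (haB : a ≤ (B : ℝ)) (I : Fin n) :
    (B : ℝ) ^ 4 * (a - 6) ^ 2 / a ^ 6 ≤ E2 n B ((a / B) ^ 2) I I := by
  have ha0 : 0 < a := by linarith
  have hBr : (0 : ℝ) < B := by linarith
  have hB : 0 < B := by exact_mod_cast hBr
  have hm1 : a / B ≤ 1 := by rwa [div_le_one hBr]
  have ht : 0 < a / B / 2 := by positivity
  have hq := cosh_half_le (m := a / B) (by positivity) hm1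
  have hg := geomfac_t_le ha0 haB
  have hg0 : 0 ≤ (1 - Real.exp (-(a / B / 2)))⁻¹ := inv_nonneg.mpr (one_sub_exp_neg_pos ht).le
  have hL' : (B : ℝ) * (a - 6) / a ≤ (B : ℝ) - 2 * (1 - Real.exp (-(a / B / 2)))⁻¹ := by
    have e : (B : ℝ) * (a - 6) / a = (B : ℝ) - 2 * (3 * B / a) := by field_simp; ring
    rw [e]; linarith
  have hL0 : 0 ≤ (B : ℝ) * (a - 6) / a := by
    have : 0 ≤ a - 6 := by linarith
    positivity
  have hL : 0 ≤ (B : ℝ) - 2 * (1 - Real.exp (-(a / B / 2)))⁻¹ := hL0.trans hL'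
  refine le_trans ?_ (E2_diag_ge hB (by positivity) ht hq hL I)
  have hmono : (((a / B) ^ 2)⁻¹ * ((B : ℝ) * (a - 6) / a)) ^ 2 / (B : ℝ) ^ 2
      ≤ (((a / B) ^ 2)⁻¹ * ((B : ℝ) - 2 * (1 - Real.exp (-(a / B / 2)))⁻¹)) ^ 2 / (B : ℝ) ^ 2 :=
    div_le_div_of_nonneg_right
      (pow_le_pow_left₀ (mul_nonneg (by positivity) hL0) (mul_le_mul_of_nonneg_left hL' (by positivity)) 2)
      (sq_nonneg _)
  refine le_trans (le_of_eq ?_) hmono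
  field_simp

/-- the dominance inequality of the threshold: `15360a⁴ ≤ (a−1)³(a−6)²` for `a ≥ 16384`. [folklore] -/
theorem threshold_poly (ha : 16384 ≤ a) : 15360 * a ^ 4 ≤ (a - 1) ^ 3 * (a - 6) ^ 2 := by
  have h0 : 0 ≤ 127 / 128 * a := by linarith
  have h1 : 127 / 128 * a ≤ a - 1 := by linarith
  have h2 : 127 / 128 * a ≤ a - 6 := by linarith
  have h3 : (127 / 128 * a) ^ 3 ≤ (a - 1) ^ 3 := pow_le_pow_left₀ h0 h1 3
  have h4 : (127 / 128 * a) ^ 2 ≤ (a - 6) ^ 2 := pow_le_pow_left₀ h0 h2 2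
  have h5 : (127 / 128 * a) ^ 3 * (127 / 128 * a) ^ 2 ≤ (a - 1) ^ 3 * (a - 6) ^ 2 :=
    mul_le_mul h3 h4 (by positivity) (pow_nonneg (by linarith) 3)
  have h6 : 15360 * a ^ 4 ≤ (127 / 128 * a) ^ 3 * (127 / 128 * a) ^ 2 := by
    have e : (127 / 128 * a) ^ 3 * (127 / 128 * a) ^ 2 = (127 / 128) ^ 5 * a * a ^ 4 := by ring
    rw [e]
    have ha4 : 0 ≤ a ^ 4 := by positivity
    have h7 : (15360 : ℝ) ≤ (127 / 128) ^ 5 * a := by nlinarith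
    nlinarith
  linarith

/-- **DOMINANCE BY A FACTOR TWO**: `2·(7680B⁴/(a²(a−1)³)) ≤ B⁴(a−6)²/a⁶` for `a ≥ 16384`. [folklore] -/
theorem dominance_num (ha : 16384 ≤ a) (hBr : (0 : ℝ) < B) :
    2 * (7680 * (B : ℝ) ^ 4 / (a ^ 2 * (a - 1) ^ 3)) ≤ (B : ℝ) ^ 4 * (a - 6) ^ 2 / a ^ 6 := by
  have ha0 : 0 < a := by linarith
  have ha1 : 0 < a - 1 := by linarith
  have ha1' : a - 1 ≠ 0 := ha1.ne'
  have hP := threshold_poly ha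
  have hX : 0 ≤ (B : ℝ) ^ 4 / (a ^ 6 * (a - 1) ^ 3) :=
    div_nonneg (by positivity) (mul_nonneg (by positivity) (pow_nonneg ha1.le 3))
  have e1 : 2 * (7680 * (B : ℝ) ^ 4 / (a ^ 2 * (a - 1) ^ 3))
      = (15360 * a ^ 4) * ((B : ℝ) ^ 4 / (a ^ 6 * (a - 1) ^ 3)) := by
    field_simp; ring
  have e2 : (B : ℝ) ^ 4 * (a - 6) ^ 2 / a ^ 6
      = ((a - 1) ^ 3 * (a - 6) ^ 2) * ((B : ℝ) ^ 4 / (a ^ 6 * (a - 1) ^ 3)) := by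
    field_simp
  rw [e1, e2]
  exact mul_le_mul_of_nonneg_right hP hX

/-- **THE CONSTANT**: `2·(B⁴(a−6)²/a⁶)⁻¹ ≤ 3a⁴·B⁻⁴` for `a ≥ 16384` (`2a² ≤ 3(a−6)²`). [folklore] -/
theorem constant_num (ha : 16384 ≤ a) (hBr : (0 : ℝ) < B) :
    2 * ((B : ℝ) ^ 4 * (a - 6) ^ 2 / a ^ 6)⁻¹ ≤ 3 * a ^ 4 * (B : ℝ) ^ (-4 : ℤ) := by
  have ha0 : 0 < a := by linarith
  have ha6 : 0 < a - 6 := by linarith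
  have ha6' : a - 6 ≠ 0 := ha6.ne'
  have key : 2 * a ^ 6 ≤ 3 * a ^ 4 * (a - 6) ^ 2 := by
    have e : 3 * a ^ 4 * (a - 6) ^ 2 - 2 * a ^ 6 = a ^ 4 * (a ^ 2 - 36 * a + 108) := by ring
    have h1 : 0 ≤ a ^ 2 - 36 * a + 108 := by nlinarith
    have h2 : 0 ≤ a ^ 4 * (a ^ 2 - 36 * a + 108) := mul_nonneg (by positivity) h1
    linarith
  rw [zpow_neg, zpow_ofNat]
  calc 2 * ((B : ℝ) ^ 4 * (a - 6) ^ 2 / a ^ 6)⁻¹ = 2 * a ^ 6 / ((B : ℝ) ^ 4 * (a - 6) ^ 2) := by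
        field_simp
    _ ≤ 3 * a ^ 4 * (a - 6) ^ 2 / ((B : ℝ) ^ 4 * (a - 6) ^ 2) :=
        div_le_div_of_nonneg_right key (by positivity)
    _ = 3 * a ^ 4 * ((B : ℝ) ^ 4)⁻¹ := by field_simp

/-- **`E₂((a/B)²)` IS INVERTIBLE** for `16384 ≤ a ≤ B`, with `Σ_J |E₂⁻¹(I,J)|e^{|I−J|/2} ≤ 2a⁶/(B⁴(a−6)²)`.
[folklore] -/
theorem isUnit_E2_num (ha : 16384 ≤ a) (haB : a ≤ (B : ℝ)) :
    IsUnit (E2 n B ((a / B) ^ 2))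
      ∧ RowLe (ewt n (1 / 2)) (E2 n B ((a / B) ^ 2))⁻¹ (2 * ((B : ℝ) ^ 4 * (a - 6) ^ 2 / a ^ 6)⁻¹) := by
  have ha0 : 0 < a := by linarith
  have ha1 : 1 < a := by linarith
  have hBr : (0 : ℝ) < B := by linarith
  have hB : 0 < B := by exact_mod_cast hBr
  have hm0 : 0 < a / B := by positivity
  have hm1 : a / B ≤ 1 := by rwa [div_le_one hBr]
  have hs : 0 < a / B / 2 - 1 / 2 / (B : ℝ) := by
    rw [srate_eq]; have : 0 < a - 1 := by linarith
    positivity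
  have hd : 0 < (B : ℝ) ^ 4 * (a - 6) ^ 2 / a ^ 6 :=
    div_pos (mul_pos (by positivity) (pow_pos (by linarith) 2)) (by positivity)
  have hD : ∀ I : Fin n, (B : ℝ) ^ 4 * (a - 6) ^ 2 / a ^ 6 ≤ E2 n B ((a / B) ^ 2) I I :=
    fun I => E2_diag_ge_num (by linarith) haB I
  have h2 : 2 * odB B (a / B) (1 / 2) ≤ (B : ℝ) ^ 4 * (a - 6) ^ 2 / a ^ 6 :=
    le_trans (mul_le_mul_of_nonneg_left (odB_num_le ha1 haB) zero_le_two) (dominance_num ha hBr)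
  have hod : 0 ≤ odB B (a / B) (1 / 2) := odB_nonneg hm0 hs
  have hq : odB B (a / B) (1 / 2) / ((B : ℝ) ^ 4 * (a - 6) ^ 2 / a ^ 6) ≤ 1 / 2 := by
    rw [div_le_iff₀ hd]; linarith
  obtain ⟨hU, hR⟩ := isUnit_E2_inv_rowLe hm0 hm1 (by norm_num) hB hs hd hD (by linarith)
  refine ⟨hU, rowLe_mono hR (mul_le_mul_of_nonneg_right ?_ (inv_nonneg.mpr hd.le))⟩
  rw [inv_le_comm₀ (by linarith) (by norm_num)]
  linarith

/-- **THE COARSE INVERSE OF THE TOY IN ITS CLASS** (census §6 (a⁵), second half, part 3): for `16384 ≤ a ≤ B` and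
`δ₀ ≤ 1/2`, `C := E₂((a/B)²)⁻¹ ∈ 𝒟(0, −4, 3a⁴)` on `toyFrame n B N hN δ₀` — the SHAPE `MOne.mC` of the cut model,
constants free of `B`, `n`, `N`. [folklore] -/
theorem E2_inv_opDec_num (ha : 16384 ≤ a) (haB : a ≤ (B : ℝ)) (hδ : δ₀ ≤ 1 / 2) :
    OpDec (toyFrame n B N hN δ₀) id id id id 0 (-4) (3 * a ^ 4) (E2 n B ((a / B) ^ 2))⁻¹ := by
  have ha0 : 0 < a := by linarith
  have ha1 : 1 < a := by linarith
  have hBr : (0 : ℝ) < B := by linarith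
  have hB : 0 < B := by exact_mod_cast hBr
  have hm0 : 0 < a / B := by positivity
  have hm1 : a / B ≤ 1 := by rwa [div_le_one hBr]
  have hs : 0 < a / B / 2 - 1 / 2 / (B : ℝ) := by
    rw [srate_eq]; have : 0 < a - 1 := by linarith
    positivity
  have hd : 0 < (B : ℝ) ^ 4 * (a - 6) ^ 2 / a ^ 6 :=
    div_pos (mul_pos (by positivity) (pow_pos (by linarith) 2)) (by positivity)
  exact E2_inv_opDec hm0 hm1 (by norm_num) hB hs hδ hd (fun I => E2_diag_ge_num (by linarith) haB I)
    (le_trans (mul_le_mul_of_nonneg_left (odB_num_le ha1 haB) zero_le_two) (dominance_num ha hBr))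
    (constant_num ha hBr)

end Numeric

end

end Literature.MathematicalPhysics.QuantumFieldTheory.Balaban1983to89.B9SectCDiffCutModelToy7
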